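import Literature.Computability.Complexity.TautCertificates
import HarnessLib

/-!
# `TAUT ∈ coNP`: the certificate checker as a stack register program

Trunk `CplxCore`. This file discharges the named fact `TAUT_mem_coNP` (`CNF.lean`):
`theorem TAUT_mem_coNP_holds : TAUT ∈ coNP`.

`TautCertificates.lean` reduced the fact to the existence of a polynomial-time string function
computing, on pairs `⟨w, y⟩`, the Boolean checker `chkTaut w y` ("`y` is the table of an
assignment falsifying the formula coded by `w`, or `w` is not a formula code"):
`TAUT_mem_coNP_of_checker`. Here the checker is programmed on the stack register machines of
`StackMachines.lean` (11 binary stack registers, 169 instructions: `TautProg.tautProg`), the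
program is proved to compute `chkTaut` within a quadratic number of steps, and
`SProg.outputFn_mem_FP` (stack register programs run in polynomial time on `TM2`) puts the
string function in `FP`.

## The program (`TautProg.tautProg`) and its verification

Registers `w w2 u t s q q2 y2 v out inp` (`TautProg.RegFile`, viewed as `Fin 11 → List Bool`
via `TautProg.mk`; `inp = 10` is the input register of `SProg.init`, `out = 9` the output).
Phases, each proved to simulate the corresponding specification function of
`TautCertificates.lean` with an explicit step budget:

* **A** (`phaseA_some`, `phaseA_none`): split the input `z = ⟨w, y⟩` (`unpairA`; a non-pair is
  rejected), then pour `w` into reading order (`pour_w`);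
* **B** (`phaseB_some`, `phaseB_none`): the unary size header, `readHdr`; the announced token
  count is kept in unary in `u`;
* **C** (`phaseC`): the tokenizer `tokRun`, pushing a stack code (`tokCode`, `rcode`) of every
  token on `s` and checking the canonicity of variable payloads; one unit of `u` is consumed
  per token, so that a count mismatch is detected during or at the end of the code
  (`COut.emit`, `phaseCE_pos`, `phaseCE_zero`);
* **D** (`phaseD`): reverse-Polish *evaluation* (`vrpn`, the value-level companion of the
  parser `rpn`: `vrpn_map`) of the token codes popped from `s`, with the values on `v`; a
  variable token moves its payload to the query registers and runs the table lookup `lookup`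
  on the certificate (`phaseK`, with the register invariant `InvK` and the amortised budget
  `bdK`), then restores the certificate and clears the query (`tokVar`);
* **E** (`phaseE`): accept unless exactly one value, `true`, remains (`verdictE`).

`halts_boolPair`: on `⟨w, y⟩` the program halts with output `[chkTaut w y]` within
`tBound |⟨w, y⟩|` steps, `tBound = 13 X² + 32 X + 16`; `tautFn_mem_FP`, `tautFn_boolPair` and
`tautFn_cases` feed `TAUT_mem_coNP_of_checker`.

Symbolic execution: `step_mk` (one step on a configuration `⟨pc, mk R⟩`: instruction fetch by
the `rfl` lemmas `tautProg_pc*`, one per address, then the register update `update_mk_*`)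
lets `simp` run the program between control states with numeral program counters; loops are
handled by inductions (`pour_*`, `clear_*`, `varLoop`, `drain`, and the phase theorems, which
follow the recursion of the specification functions).

## References

* S. A. Cook, *The complexity of theorem-proving procedures*, Proc. 3rd STOC (1971), 151–158,
  §1 (non-tautologies are accepted nondeterministically in polynomial time by guessing a
  falsifying assignment).
* S. Arora, B. Barak, *Computational Complexity: A Modern Approach*, Cambridge UP 2009,
  Example 2.21 (`TAUTOLOGY` and `coNP`), Def. 2.19–2.20, §0.1 (pairing of strings), §1.3–1.4.
* M. L. Minsky, *Computation: Finite and Infinite Machines*, Prentice-Hall 1967, §11.1, §14.1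
  (the machine model; see `StackMachines.lean`).
-/

namespace Literature.Computability.Complexity

open _root_.Computability

namespace TautProg

/-- The register file of the checker program, by name: `w` (the instance, reversed), `w2` (the
instance in reading order), `u` (unary token budget), `t` (payload accumulator), `s` (token
stack), `q`/`q2` (query payload: read part / unread part), `y2` (read part of the certificate),
`v` (value stack), `out` (output), `inp` (input; then the certificate). [folklore] -/
structure RegFile where
  (w w2 u t s q q2 y2 v out inp : List Bool)

/-- The register file as a function `Fin 11 → List Bool` (register `10 = Fin.last 10` is the
input register of `SProg.init`). [folklore] -/
def mk (R : RegFile) : Fin 11 → List Bool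
  | ⟨0, _⟩ => R.w
  | ⟨1, _⟩ => R.w2
  | ⟨2, _⟩ => R.u
  | ⟨3, _⟩ => R.t
  | ⟨4, _⟩ => R.s
  | ⟨5, _⟩ => R.q
  | ⟨6, _⟩ => R.q2
  | ⟨7, _⟩ => R.y2
  | ⟨8, _⟩ => R.v
  | ⟨9, _⟩ => R.out
  | ⟨10, _⟩ => R.inp
  | ⟨n + 11, h⟩ => absurd h (by omega)

/-- register `0` is `w`. [folklore] -/
@[simp] theorem mk_0 (R : RegFile) : mk R 0 = R.w := rfl
/-- register `1` is `w2`. [folklore] -/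
@[simp] theorem mk_1 (R : RegFile) : mk R 1 = R.w2 := rfl
/-- register `2` is `u`. [folklore] -/
@[simp] theorem mk_2 (R : RegFile) : mk R 2 = R.u := rfl
/-- register `3` is `t`. [folklore] -/
@[simp] theorem mk_3 (R : RegFile) : mk R 3 = R.t := rfl
/-- register `4` is `s`. [folklore] -/
@[simp] theorem mk_4 (R : RegFile) : mk R 4 = R.s := rfl
/-- register `5` is `q`. [folklore] -/
@[simp] theorem mk_5 (R : RegFile) : mk R 5 = R.q := rfl
/-- register `6` is `q2`. [folklore] -/
@[simp] theorem mk_6 (R : RegFile) : mk R 6 = R.q2 := rfl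
/-- register `7` is `y2`. [folklore] -/
@[simp] theorem mk_7 (R : RegFile) : mk R 7 = R.y2 := rfl
/-- register `8` is `v`. [folklore] -/
@[simp] theorem mk_8 (R : RegFile) : mk R 8 = R.v := rfl
/-- register `9` is `out`. [folklore] -/
@[simp] theorem mk_9 (R : RegFile) : mk R 9 = R.out := rfl
/-- register `10` is `inp`. [folklore] -/
@[simp] theorem mk_10 (R : RegFile) : mk R 10 = R.inp := rfl
/-- updating register `0` (`w`). [folklore] -/
@[simp] theorem update_mk_0 (R : RegFile) (x : List Bool) :
    Function.update (mk R) 0 x = mk { R with w := x } := by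
  funext i
  by_cases h : i = 0
  · subst h; simp [mk]
  · rw [Function.update_of_ne h]
    match i, h with
    | ⟨0, _⟩, h => exact absurd rfl h
    | ⟨1, _⟩, _ => rfl
    | ⟨2, _⟩, _ => rfl
    | ⟨3, _⟩, _ => rfl
    | ⟨4, _⟩, _ => rfl
    | ⟨5, _⟩, _ => rfl
    | ⟨6, _⟩, _ => rfl
    | ⟨7, _⟩, _ => rfl
    | ⟨8, _⟩, _ => rfl
    | ⟨9, _⟩, _ => rfl
    | ⟨10, _⟩, _ => rfl
/-- updating register `1` (`w2`). [folklore] -/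
@[simp] theorem update_mk_1 (R : RegFile) (x : List Bool) :
    Function.update (mk R) 1 x = mk { R with w2 := x } := by
  funext i
  by_cases h : i = 1
  · subst h; simp [mk]
  · rw [Function.update_of_ne h]
    match i, h with
    | ⟨0, _⟩, _ => rfl
    | ⟨1, _⟩, h => exact absurd rfl h
    | ⟨2, _⟩, _ => rfl
    | ⟨3, _⟩, _ => rfl
    | ⟨4, _⟩, _ => rfl
    | ⟨5, _⟩, _ => rfl
    | ⟨6, _⟩, _ => rfl
    | ⟨7, _⟩, _ => rfl
    | ⟨8, _⟩, _ => rfl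
    | ⟨9, _⟩, _ => rfl
    | ⟨10, _⟩, _ => rfl
/-- updating register `2` (`u`). [folklore] -/
@[simp] theorem update_mk_2 (R : RegFile) (x : List Bool) :
    Function.update (mk R) 2 x = mk { R with u := x } := by
  funext i
  by_cases h : i = 2
  · subst h; simp [mk]
  · rw [Function.update_of_ne h]
    match i, h with
    | ⟨0, _⟩, _ => rfl
    | ⟨1, _⟩, _ => rfl
    | ⟨2, _⟩, h => exact absurd rfl h
    | ⟨3, _⟩, _ => rfl
    | ⟨4, _⟩, _ => rfl
    | ⟨5, _⟩, _ => rfl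
    | ⟨6, _⟩, _ => rfl
    | ⟨7, _⟩, _ => rfl
    | ⟨8, _⟩, _ => rfl
    | ⟨9, _⟩, _ => rfl
    | ⟨10, _⟩, _ => rfl
/-- updating register `3` (`t`). [folklore] -/
@[simp] theorem update_mk_3 (R : RegFile) (x : List Bool) :
    Function.update (mk R) 3 x = mk { R with t := x } := by
  funext i
  by_cases h : i = 3
  · subst h; simp [mk]
  · rw [Function.update_of_ne h]
    match i, h with
    | ⟨0, _⟩, _ => rfl
    | ⟨1, _⟩, _ => rfl
    | ⟨2, _⟩, _ => rfl
    | ⟨3, _⟩, h => exact absurd rfl h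
    | ⟨4, _⟩, _ => rfl
    | ⟨5, _⟩, _ => rfl
    | ⟨6, _⟩, _ => rfl
    | ⟨7, _⟩, _ => rfl
    | ⟨8, _⟩, _ => rfl
    | ⟨9, _⟩, _ => rfl
    | ⟨10, _⟩, _ => rfl
/-- updating register `4` (`s`). [folklore] -/
@[simp] theorem update_mk_4 (R : RegFile) (x : List Bool) :
    Function.update (mk R) 4 x = mk { R with s := x } := by
  funext i
  by_cases h : i = 4
  · subst h; simp [mk]
  · rw [Function.update_of_ne h]
    match i, h with
    | ⟨0, _⟩, _ => rfl
    | ⟨1, _⟩, _ => rfl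
    | ⟨2, _⟩, _ => rfl
    | ⟨3, _⟩, _ => rfl
    | ⟨4, _⟩, h => exact absurd rfl h
    | ⟨5, _⟩, _ => rfl
    | ⟨6, _⟩, _ => rfl
    | ⟨7, _⟩, _ => rfl
    | ⟨8, _⟩, _ => rfl
    | ⟨9, _⟩, _ => rfl
    | ⟨10, _⟩, _ => rfl
/-- updating register `5` (`q`). [folklore] -/
@[simp] theorem update_mk_5 (R : RegFile) (x : List Bool) :
    Function.update (mk R) 5 x = mk { R with q := x } := by
  funext i
  by_cases h : i = 5
  · subst h; simp [mk]
  · rw [Function.update_of_ne h]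
    match i, h with
    | ⟨0, _⟩, _ => rfl
    | ⟨1, _⟩, _ => rfl
    | ⟨2, _⟩, _ => rfl
    | ⟨3, _⟩, _ => rfl
    | ⟨4, _⟩, _ => rfl
    | ⟨5, _⟩, h => exact absurd rfl h
    | ⟨6, _⟩, _ => rfl
    | ⟨7, _⟩, _ => rfl
    | ⟨8, _⟩, _ => rfl
    | ⟨9, _⟩, _ => rfl
    | ⟨10, _⟩, _ => rfl
/-- updating register `6` (`q2`). [folklore] -/
@[simp] theorem update_mk_6 (R : RegFile) (x : List Bool) :
    Function.update (mk R) 6 x = mk { R with q2 := x } := by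
  funext i
  by_cases h : i = 6
  · subst h; simp [mk]
  · rw [Function.update_of_ne h]
    match i, h with
    | ⟨0, _⟩, _ => rfl
    | ⟨1, _⟩, _ => rfl
    | ⟨2, _⟩, _ => rfl
    | ⟨3, _⟩, _ => rfl
    | ⟨4, _⟩, _ => rfl
    | ⟨5, _⟩, _ => rfl
    | ⟨6, _⟩, h => exact absurd rfl h
    | ⟨7, _⟩, _ => rfl
    | ⟨8, _⟩, _ => rfl
    | ⟨9, _⟩, _ => rfl
    | ⟨10, _⟩, _ => rfl
/-- updating register `7` (`y2`). [folklore] -/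
@[simp] theorem update_mk_7 (R : RegFile) (x : List Bool) :
    Function.update (mk R) 7 x = mk { R with y2 := x } := by
  funext i
  by_cases h : i = 7
  · subst h; simp [mk]
  · rw [Function.update_of_ne h]
    match i, h with
    | ⟨0, _⟩, _ => rfl
    | ⟨1, _⟩, _ => rfl
    | ⟨2, _⟩, _ => rfl
    | ⟨3, _⟩, _ => rfl
    | ⟨4, _⟩, _ => rfl
    | ⟨5, _⟩, _ => rfl
    | ⟨6, _⟩, _ => rfl
    | ⟨7, _⟩, h => exact absurd rfl h
    | ⟨8, _⟩, _ => rfl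
    | ⟨9, _⟩, _ => rfl
    | ⟨10, _⟩, _ => rfl
/-- updating register `8` (`v`). [folklore] -/
@[simp] theorem update_mk_8 (R : RegFile) (x : List Bool) :
    Function.update (mk R) 8 x = mk { R with v := x } := by
  funext i
  by_cases h : i = 8
  · subst h; simp [mk]
  · rw [Function.update_of_ne h]
    match i, h with
    | ⟨0, _⟩, _ => rfl
    | ⟨1, _⟩, _ => rfl
    | ⟨2, _⟩, _ => rfl
    | ⟨3, _⟩, _ => rfl
    | ⟨4, _⟩, _ => rfl
    | ⟨5, _⟩, _ => rfl
    | ⟨6, _⟩, _ => rfl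
    | ⟨7, _⟩, _ => rfl
    | ⟨8, _⟩, h => exact absurd rfl h
    | ⟨9, _⟩, _ => rfl
    | ⟨10, _⟩, _ => rfl
/-- updating register `9` (`out`). [folklore] -/
@[simp] theorem update_mk_9 (R : RegFile) (x : List Bool) :
    Function.update (mk R) 9 x = mk { R with out := x } := by
  funext i
  by_cases h : i = 9
  · subst h; simp [mk]
  · rw [Function.update_of_ne h]
    match i, h with
    | ⟨0, _⟩, _ => rfl
    | ⟨1, _⟩, _ => rfl
    | ⟨2, _⟩, _ => rfl
    | ⟨3, _⟩, _ => rfl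
    | ⟨4, _⟩, _ => rfl
    | ⟨5, _⟩, _ => rfl
    | ⟨6, _⟩, _ => rfl
    | ⟨7, _⟩, _ => rfl
    | ⟨8, _⟩, _ => rfl
    | ⟨9, _⟩, h => exact absurd rfl h
    | ⟨10, _⟩, _ => rfl
/-- updating register `10` (`inp`). [folklore] -/
@[simp] theorem update_mk_10 (R : RegFile) (x : List Bool) :
    Function.update (mk R) 10 x = mk { R with inp := x } := by
  funext i
  by_cases h : i = 10
  · subst h; simp [mk]
  · rw [Function.update_of_ne h]
    match i, h with
    | ⟨0, _⟩, _ => rfl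
    | ⟨1, _⟩, _ => rfl
    | ⟨2, _⟩, _ => rfl
    | ⟨3, _⟩, _ => rfl
    | ⟨4, _⟩, _ => rfl
    | ⟨5, _⟩, _ => rfl
    | ⟨6, _⟩, _ => rfl
    | ⟨7, _⟩, _ => rfl
    | ⟨8, _⟩, _ => rfl
    | ⟨9, _⟩, _ => rfl
    | ⟨10, _⟩, h => exact absurd rfl h

/-- **The checker program** (`169` instructions on 11 registers `w w2 u t s q q2 y2 v out inp`;
labels in the comments; generated together with the fetch/step lemmas below from one listing).
[folklore] -/
def tautProg : SProg 11 :=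
  [
    .pop 10 1 4 167,   -- 0 A0
    .pop 10 2 167 167,   -- 1 A1t
    .push 0 true,   -- 2 A2t
    .goto 0,   -- 3 
    .pop 10 7 5 167,   -- 4 A1f
    .push 0 false,   -- 5 A2f
    .goto 0,   -- 6 
    .pop 0 8 10 12,   -- 7 P0
    .push 1 true,   -- 8 P1t
    .goto 7,   -- 9 
    .push 1 false,   -- 10 P1f
    .goto 7,   -- 11 
    .pop 1 13 16 165,   -- 12 B0
    .pop 1 14 165 165,   -- 13 B1t
    .push 2 true,   -- 14 B2
    .goto 12,   -- 15 
    .pop 1 17 165 165,   -- 16 B1f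
    .pop 1 28 18 63,   -- 17 C0
    .pop 1 19 42 165,   -- 18 C0f
    .pop 1 20 24 165,   -- 19 Ccst
    .push 4 true,   -- 20 CcT
    .push 4 false,   -- 21 
    .push 4 false,   -- 22 
    .goto 41,   -- 23 
    .push 4 false,   -- 24 CcF
    .push 4 false,   -- 25 
    .push 4 false,   -- 26 
    .goto 41,   -- 27 
    .pop 1 32 29 165,   -- 28 C1
    .push 4 false,   -- 29 Cneg
    .push 4 true,   -- 30 
    .goto 41,   -- 31 
    .pop 1 37 33 165,   -- 32 C11
    .push 4 false,   -- 33 Cconj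
    .push 4 true,   -- 34 
    .push 4 true,   -- 35 
    .goto 41,   -- 36 
    .push 4 true,   -- 37 Cdisj
    .push 4 true,   -- 38 
    .push 4 true,   -- 39 
    .goto 41,   -- 40 
    .pop 2 17 165 165,   -- 41 CNT
    .pop 1 44 47 165,   -- 42 Cp0ok
    .pop 1 44 48 165,   -- 43 Cp0F
    .pop 1 45 165 165,   -- 44 Cp1t
    .push 3 true,   -- 45 CpT
    .goto 42,   -- 46 
    .pop 1 51 49 165,   -- 47 Cp1fok
    .pop 1 165 49 165,   -- 48 Cp1fbad
    .push 3 false,   -- 49 CpF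
    .goto 43,   -- 50 
    .push 4 false,   -- 51 Cvar
    .goto 53,   -- 52 
    .pop 3 54 57 60,   -- 53 CvL
    .push 4 true,   -- 54 CvT
    .push 4 true,   -- 55 
    .goto 53,   -- 56 
    .push 4 false,   -- 57 CvF
    .push 4 true,   -- 58 
    .goto 53,   -- 59 
    .push 4 true,   -- 60 CvE
    .push 4 false,   -- 61 
    .goto 41,   -- 62 
    .pop 2 165 165 64,   -- 63 CE
    .pop 4 71 65 163,   -- 64 D0
    .pop 4 80 66 165,   -- 65 Dleaf
    .pop 4 67 69 165,   -- 66 Dconst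
    .push 8 true,   -- 67 PVT
    .goto 64,   -- 68 
    .push 8 false,   -- 69 PVF
    .goto 64,   -- 70 
    .pop 4 73 72 165,   -- 71 Dop
    .pop 8 69 67 165,   -- 72 Dneg
    .pop 4 77 74 165,   -- 73 Dop2
    .pop 8 75 76 165,   -- 74 Dconj
    .pop 8 67 69 165,   -- 75 DcjT
    .pop 8 69 69 165,   -- 76 DcjF
    .pop 8 78 79 165,   -- 77 Ddisj
    .pop 8 67 67 165,   -- 78 DdjT
    .pop 8 67 69 165,   -- 79 DdjF
    .pop 4 81 86 165,   -- 80 DvarL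
    .pop 4 82 84 165,   -- 81 Dvb
    .push 5 true,   -- 82 DvbT
    .goto 80,   -- 83 
    .push 5 false,   -- 84 DvbF
    .goto 80,   -- 85 
    .pop 5 87 89 91,   -- 86 QP0
    .push 6 true,   -- 87 QP1t
    .goto 86,   -- 88 
    .push 6 false,   -- 89 QP1f
    .goto 86,   -- 90 
    .pop 10 92 94 151,   -- 91 K0m
    .push 7 true,   -- 92 K0mT
    .goto 96,   -- 93 
    .push 7 false,   -- 94 K0mF
    .goto 101,   -- 95 
    .pop 10 97 99 151,   -- 96 K1mt
    .push 7 true,   -- 97 K1mtT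
    .goto 106,   -- 98 
    .push 7 false,   -- 99 K1mtF
    .goto 151,   -- 100 
    .pop 10 102 104 151,   -- 101 K1mf
    .push 7 true,   -- 102 K1mfT
    .goto 131,   -- 103 
    .push 7 false,   -- 104 K1mfF
    .goto 111,   -- 105 
    .pop 6 107 109 116,   -- 106 KBm1
    .push 5 true,   -- 107 KBm1T
    .goto 91,   -- 108 
    .push 5 false,   -- 109 KBm1F
    .goto 116,   -- 110 
    .pop 6 112 114 116,   -- 111 KBm0
    .push 5 true,   -- 112 KBm0T
    .goto 116,   -- 113 
    .push 5 false,   -- 114 KBm0F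
    .goto 91,   -- 115 
    .pop 10 117 119 151,   -- 116 K0n
    .push 7 true,   -- 117 K0nT
    .goto 121,   -- 118 
    .push 7 false,   -- 119 K0nF
    .goto 126,   -- 120 
    .pop 10 122 124 151,   -- 121 K1nt
    .push 7 true,   -- 122 K1ntT
    .goto 116,   -- 123 
    .push 7 false,   -- 124 K1ntF
    .goto 151,   -- 125 
    .pop 10 127 129 151,   -- 126 K1nf
    .push 7 true,   -- 127 K1nfT
    .goto 141,   -- 128 
    .push 7 false,   -- 129 K1nfF
    .goto 116,   -- 130 
    .pop 6 132 134 136,   -- 131 KENDm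
    .push 6 true,   -- 132 KEt
    .goto 141,   -- 133 
    .push 6 false,   -- 134 KEf
    .goto 141,   -- 135 
    .pop 10 137 139 151,   -- 136 KVm
    .push 7 true,   -- 137 KVmT
    .goto 152,   -- 138 
    .push 7 false,   -- 139 KVmF
    .goto 154,   -- 140 
    .pop 10 142 144 151,   -- 141 KVn
    .push 7 true,   -- 142 KVnT
    .goto 146,   -- 143 
    .push 7 false,   -- 144 KVnF
    .goto 146,   -- 145 
    .pop 5 147 149 91,   -- 146 QR
    .push 6 true,   -- 147 QRt
    .goto 146,   -- 148 
    .push 6 false,   -- 149 QRf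
    .goto 146,   -- 150 
    .goto 154,   -- 151 LFAIL
    .push 8 true,   -- 152 RESt
    .goto 156,   -- 153 
    .push 8 false,   -- 154 RESf
    .goto 156,   -- 155 
    .pop 7 157 159 161,   -- 156 RY
    .push 10 true,   -- 157 RYt
    .goto 156,   -- 158 
    .push 10 false,   -- 159 RYf
    .goto 156,   -- 160 
    .pop 5 161 161 162,   -- 161 CQ
    .pop 6 162 162 64,   -- 162 CQ2
    .pop 8 164 165 165,   -- 163 E0
    .pop 8 165 165 167,   -- 164 E1t
    .push 9 true,   -- 165 ACC
    .goto 169,   -- 166 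
    .push 9 false,   -- 167 REJ
    .goto 169 ]   -- 168 

set_option maxRecDepth 8192 in
/-- The program has `169` instructions (`169` = the halting address `HALT`). [folklore] -/
theorem tautProg_length : tautProg.length = 169 := rfl

/-! #### Instruction fetch (one `rfl` lemma per address) -/
section Fetch
set_option maxRecDepth 8192
/-- fetch at `0` (A0). [folklore] -/
@[simp] theorem tautProg_pc0 : tautProg[0]? = some (.pop 10 1 4 167) := rfl
/-- fetch at `1` (A1t). [folklore] -/
@[simp] theorem tautProg_pc1 : tautProg[1]? = some (.pop 10 2 167 167) := rfl
/-- fetch at `2` (A2t). [folklore] -/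
@[simp] theorem tautProg_pc2 : tautProg[2]? = some (.push 0 true) := rfl
/-- fetch at `3`. [folklore] -/
@[simp] theorem tautProg_pc3 : tautProg[3]? = some (.goto 0) := rfl
/-- fetch at `4` (A1f). [folklore] -/
@[simp] theorem tautProg_pc4 : tautProg[4]? = some (.pop 10 7 5 167) := rfl
/-- fetch at `5` (A2f). [folklore] -/
@[simp] theorem tautProg_pc5 : tautProg[5]? = some (.push 0 false) := rfl
/-- fetch at `6`. [folklore] -/
@[simp] theorem tautProg_pc6 : tautProg[6]? = some (.goto 0) := rfl
/-- fetch at `7` (P0). [folklore] -/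
@[simp] theorem tautProg_pc7 : tautProg[7]? = some (.pop 0 8 10 12) := rfl
/-- fetch at `8` (P1t). [folklore] -/
@[simp] theorem tautProg_pc8 : tautProg[8]? = some (.push 1 true) := rfl
/-- fetch at `9`. [folklore] -/
@[simp] theorem tautProg_pc9 : tautProg[9]? = some (.goto 7) := rfl
/-- fetch at `10` (P1f). [folklore] -/
@[simp] theorem tautProg_pc10 : tautProg[10]? = some (.push 1 false) := rfl
/-- fetch at `11`. [folklore] -/
@[simp] theorem tautProg_pc11 : tautProg[11]? = some (.goto 7) := rfl
/-- fetch at `12` (B0). [folklore] -/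
@[simp] theorem tautProg_pc12 : tautProg[12]? = some (.pop 1 13 16 165) := rfl
/-- fetch at `13` (B1t). [folklore] -/
@[simp] theorem tautProg_pc13 : tautProg[13]? = some (.pop 1 14 165 165) := rfl
/-- fetch at `14` (B2). [folklore] -/
@[simp] theorem tautProg_pc14 : tautProg[14]? = some (.push 2 true) := rfl
/-- fetch at `15`. [folklore] -/
@[simp] theorem tautProg_pc15 : tautProg[15]? = some (.goto 12) := rfl
/-- fetch at `16` (B1f). [folklore] -/
@[simp] theorem tautProg_pc16 : tautProg[16]? = some (.pop 1 17 165 165) := rfl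
/-- fetch at `17` (C0). [folklore] -/
@[simp] theorem tautProg_pc17 : tautProg[17]? = some (.pop 1 28 18 63) := rfl
/-- fetch at `18` (C0f). [folklore] -/
@[simp] theorem tautProg_pc18 : tautProg[18]? = some (.pop 1 19 42 165) := rfl
/-- fetch at `19` (Ccst). [folklore] -/
@[simp] theorem tautProg_pc19 : tautProg[19]? = some (.pop 1 20 24 165) := rfl
/-- fetch at `20` (CcT). [folklore] -/
@[simp] theorem tautProg_pc20 : tautProg[20]? = some (.push 4 true) := rfl
/-- fetch at `21`. [folklore] -/
@[simp] theorem tautProg_pc21 : tautProg[21]? = some (.push 4 false) := rfl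
/-- fetch at `22`. [folklore] -/
@[simp] theorem tautProg_pc22 : tautProg[22]? = some (.push 4 false) := rfl
/-- fetch at `23`. [folklore] -/
@[simp] theorem tautProg_pc23 : tautProg[23]? = some (.goto 41) := rfl
/-- fetch at `24` (CcF). [folklore] -/
@[simp] theorem tautProg_pc24 : tautProg[24]? = some (.push 4 false) := rfl
/-- fetch at `25`. [folklore] -/
@[simp] theorem tautProg_pc25 : tautProg[25]? = some (.push 4 false) := rfl
/-- fetch at `26`. [folklore] -/
@[simp] theorem tautProg_pc26 : tautProg[26]? = some (.push 4 false) := rfl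
/-- fetch at `27`. [folklore] -/
@[simp] theorem tautProg_pc27 : tautProg[27]? = some (.goto 41) := rfl
/-- fetch at `28` (C1). [folklore] -/
@[simp] theorem tautProg_pc28 : tautProg[28]? = some (.pop 1 32 29 165) := rfl
/-- fetch at `29` (Cneg). [folklore] -/
@[simp] theorem tautProg_pc29 : tautProg[29]? = some (.push 4 false) := rfl
/-- fetch at `30`. [folklore] -/
@[simp] theorem tautProg_pc30 : tautProg[30]? = some (.push 4 true) := rfl
/-- fetch at `31`. [folklore] -/
@[simp] theorem tautProg_pc31 : tautProg[31]? = some (.goto 41) := rfl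
/-- fetch at `32` (C11). [folklore] -/
@[simp] theorem tautProg_pc32 : tautProg[32]? = some (.pop 1 37 33 165) := rfl
/-- fetch at `33` (Cconj). [folklore] -/
@[simp] theorem tautProg_pc33 : tautProg[33]? = some (.push 4 false) := rfl
/-- fetch at `34`. [folklore] -/
@[simp] theorem tautProg_pc34 : tautProg[34]? = some (.push 4 true) := rfl
/-- fetch at `35`. [folklore] -/
@[simp] theorem tautProg_pc35 : tautProg[35]? = some (.push 4 true) := rfl
/-- fetch at `36`. [folklore] -/
@[simp] theorem tautProg_pc36 : tautProg[36]? = some (.goto 41) := rfl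
/-- fetch at `37` (Cdisj). [folklore] -/
@[simp] theorem tautProg_pc37 : tautProg[37]? = some (.push 4 true) := rfl
/-- fetch at `38`. [folklore] -/
@[simp] theorem tautProg_pc38 : tautProg[38]? = some (.push 4 true) := rfl
/-- fetch at `39`. [folklore] -/
@[simp] theorem tautProg_pc39 : tautProg[39]? = some (.push 4 true) := rfl
/-- fetch at `40`. [folklore] -/
@[simp] theorem tautProg_pc40 : tautProg[40]? = some (.goto 41) := rfl
/-- fetch at `41` (CNT). [folklore] -/
@[simp] theorem tautProg_pc41 : tautProg[41]? = some (.pop 2 17 165 165) := rfl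
/-- fetch at `42` (Cp0ok). [folklore] -/
@[simp] theorem tautProg_pc42 : tautProg[42]? = some (.pop 1 44 47 165) := rfl
/-- fetch at `43` (Cp0F). [folklore] -/
@[simp] theorem tautProg_pc43 : tautProg[43]? = some (.pop 1 44 48 165) := rfl
/-- fetch at `44` (Cp1t). [folklore] -/
@[simp] theorem tautProg_pc44 : tautProg[44]? = some (.pop 1 45 165 165) := rfl
/-- fetch at `45` (CpT). [folklore] -/
@[simp] theorem tautProg_pc45 : tautProg[45]? = some (.push 3 true) := rfl
/-- fetch at `46`. [folklore] -/
@[simp] theorem tautProg_pc46 : tautProg[46]? = some (.goto 42) := rfl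
/-- fetch at `47` (Cp1fok). [folklore] -/
@[simp] theorem tautProg_pc47 : tautProg[47]? = some (.pop 1 51 49 165) := rfl
/-- fetch at `48` (Cp1fbad). [folklore] -/
@[simp] theorem tautProg_pc48 : tautProg[48]? = some (.pop 1 165 49 165) := rfl
/-- fetch at `49` (CpF). [folklore] -/
@[simp] theorem tautProg_pc49 : tautProg[49]? = some (.push 3 false) := rfl
/-- fetch at `50`. [folklore] -/
@[simp] theorem tautProg_pc50 : tautProg[50]? = some (.goto 43) := rfl
/-- fetch at `51` (Cvar). [folklore] -/
@[simp] theorem tautProg_pc51 : tautProg[51]? = some (.push 4 false) := rfl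
/-- fetch at `52`. [folklore] -/
@[simp] theorem tautProg_pc52 : tautProg[52]? = some (.goto 53) := rfl
/-- fetch at `53` (CvL). [folklore] -/
@[simp] theorem tautProg_pc53 : tautProg[53]? = some (.pop 3 54 57 60) := rfl
/-- fetch at `54` (CvT). [folklore] -/
@[simp] theorem tautProg_pc54 : tautProg[54]? = some (.push 4 true) := rfl
/-- fetch at `55`. [folklore] -/
@[simp] theorem tautProg_pc55 : tautProg[55]? = some (.push 4 true) := rfl
/-- fetch at `56`. [folklore] -/
@[simp] theorem tautProg_pc56 : tautProg[56]? = some (.goto 53) := rfl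
/-- fetch at `57` (CvF). [folklore] -/
@[simp] theorem tautProg_pc57 : tautProg[57]? = some (.push 4 false) := rfl
/-- fetch at `58`. [folklore] -/
@[simp] theorem tautProg_pc58 : tautProg[58]? = some (.push 4 true) := rfl
/-- fetch at `59`. [folklore] -/
@[simp] theorem tautProg_pc59 : tautProg[59]? = some (.goto 53) := rfl
/-- fetch at `60` (CvE). [folklore] -/
@[simp] theorem tautProg_pc60 : tautProg[60]? = some (.push 4 true) := rfl
/-- fetch at `61`. [folklore] -/
@[simp] theorem tautProg_pc61 : tautProg[61]? = some (.push 4 false) := rfl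
/-- fetch at `62`. [folklore] -/
@[simp] theorem tautProg_pc62 : tautProg[62]? = some (.goto 41) := rfl
/-- fetch at `63` (CE). [folklore] -/
@[simp] theorem tautProg_pc63 : tautProg[63]? = some (.pop 2 165 165 64) := rfl
/-- fetch at `64` (D0). [folklore] -/
@[simp] theorem tautProg_pc64 : tautProg[64]? = some (.pop 4 71 65 163) := rfl
/-- fetch at `65` (Dleaf). [folklore] -/
@[simp] theorem tautProg_pc65 : tautProg[65]? = some (.pop 4 80 66 165) := rfl
/-- fetch at `66` (Dconst). [folklore] -/
@[simp] theorem tautProg_pc66 : tautProg[66]? = some (.pop 4 67 69 165) := rfl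
/-- fetch at `67` (PVT). [folklore] -/
@[simp] theorem tautProg_pc67 : tautProg[67]? = some (.push 8 true) := rfl
/-- fetch at `68`. [folklore] -/
@[simp] theorem tautProg_pc68 : tautProg[68]? = some (.goto 64) := rfl
/-- fetch at `69` (PVF). [folklore] -/
@[simp] theorem tautProg_pc69 : tautProg[69]? = some (.push 8 false) := rfl
/-- fetch at `70`. [folklore] -/
@[simp] theorem tautProg_pc70 : tautProg[70]? = some (.goto 64) := rfl
/-- fetch at `71` (Dop). [folklore] -/
@[simp] theorem tautProg_pc71 : tautProg[71]? = some (.pop 4 73 72 165) := rfl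
/-- fetch at `72` (Dneg). [folklore] -/
@[simp] theorem tautProg_pc72 : tautProg[72]? = some (.pop 8 69 67 165) := rfl
/-- fetch at `73` (Dop2). [folklore] -/
@[simp] theorem tautProg_pc73 : tautProg[73]? = some (.pop 4 77 74 165) := rfl
/-- fetch at `74` (Dconj). [folklore] -/
@[simp] theorem tautProg_pc74 : tautProg[74]? = some (.pop 8 75 76 165) := rfl
/-- fetch at `75` (DcjT). [folklore] -/
@[simp] theorem tautProg_pc75 : tautProg[75]? = some (.pop 8 67 69 165) := rfl
/-- fetch at `76` (DcjF). [folklore] -/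
@[simp] theorem tautProg_pc76 : tautProg[76]? = some (.pop 8 69 69 165) := rfl
/-- fetch at `77` (Ddisj). [folklore] -/
@[simp] theorem tautProg_pc77 : tautProg[77]? = some (.pop 8 78 79 165) := rfl
/-- fetch at `78` (DdjT). [folklore] -/
@[simp] theorem tautProg_pc78 : tautProg[78]? = some (.pop 8 67 67 165) := rfl
/-- fetch at `79` (DdjF). [folklore] -/
@[simp] theorem tautProg_pc79 : tautProg[79]? = some (.pop 8 67 69 165) := rfl
/-- fetch at `80` (DvarL). [folklore] -/
@[simp] theorem tautProg_pc80 : tautProg[80]? = some (.pop 4 81 86 165) := rfl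
/-- fetch at `81` (Dvb). [folklore] -/
@[simp] theorem tautProg_pc81 : tautProg[81]? = some (.pop 4 82 84 165) := rfl
/-- fetch at `82` (DvbT). [folklore] -/
@[simp] theorem tautProg_pc82 : tautProg[82]? = some (.push 5 true) := rfl
/-- fetch at `83`. [folklore] -/
@[simp] theorem tautProg_pc83 : tautProg[83]? = some (.goto 80) := rfl
/-- fetch at `84` (DvbF). [folklore] -/
@[simp] theorem tautProg_pc84 : tautProg[84]? = some (.push 5 false) := rfl
/-- fetch at `85`. [folklore] -/
@[simp] theorem tautProg_pc85 : tautProg[85]? = some (.goto 80) := rfl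
/-- fetch at `86` (QP0). [folklore] -/
@[simp] theorem tautProg_pc86 : tautProg[86]? = some (.pop 5 87 89 91) := rfl
/-- fetch at `87` (QP1t). [folklore] -/
@[simp] theorem tautProg_pc87 : tautProg[87]? = some (.push 6 true) := rfl
/-- fetch at `88`. [folklore] -/
@[simp] theorem tautProg_pc88 : tautProg[88]? = some (.goto 86) := rfl
/-- fetch at `89` (QP1f). [folklore] -/
@[simp] theorem tautProg_pc89 : tautProg[89]? = some (.push 6 false) := rfl
/-- fetch at `90`. [folklore] -/
@[simp] theorem tautProg_pc90 : tautProg[90]? = some (.goto 86) := rfl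
/-- fetch at `91` (K0m). [folklore] -/
@[simp] theorem tautProg_pc91 : tautProg[91]? = some (.pop 10 92 94 151) := rfl
/-- fetch at `92` (K0mT). [folklore] -/
@[simp] theorem tautProg_pc92 : tautProg[92]? = some (.push 7 true) := rfl
/-- fetch at `93`. [folklore] -/
@[simp] theorem tautProg_pc93 : tautProg[93]? = some (.goto 96) := rfl
/-- fetch at `94` (K0mF). [folklore] -/
@[simp] theorem tautProg_pc94 : tautProg[94]? = some (.push 7 false) := rfl
/-- fetch at `95`. [folklore] -/
@[simp] theorem tautProg_pc95 : tautProg[95]? = some (.goto 101) := rfl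
/-- fetch at `96` (K1mt). [folklore] -/
@[simp] theorem tautProg_pc96 : tautProg[96]? = some (.pop 10 97 99 151) := rfl
/-- fetch at `97` (K1mtT). [folklore] -/
@[simp] theorem tautProg_pc97 : tautProg[97]? = some (.push 7 true) := rfl
/-- fetch at `98`. [folklore] -/
@[simp] theorem tautProg_pc98 : tautProg[98]? = some (.goto 106) := rfl
/-- fetch at `99` (K1mtF). [folklore] -/
@[simp] theorem tautProg_pc99 : tautProg[99]? = some (.push 7 false) := rfl
/-- fetch at `100`. [folklore] -/
@[simp] theorem tautProg_pc100 : tautProg[100]? = some (.goto 151) := rfl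
/-- fetch at `101` (K1mf). [folklore] -/
@[simp] theorem tautProg_pc101 : tautProg[101]? = some (.pop 10 102 104 151) := rfl
/-- fetch at `102` (K1mfT). [folklore] -/
@[simp] theorem tautProg_pc102 : tautProg[102]? = some (.push 7 true) := rfl
/-- fetch at `103`. [folklore] -/
@[simp] theorem tautProg_pc103 : tautProg[103]? = some (.goto 131) := rfl
/-- fetch at `104` (K1mfF). [folklore] -/
@[simp] theorem tautProg_pc104 : tautProg[104]? = some (.push 7 false) := rfl
/-- fetch at `105`. [folklore] -/
@[simp] theorem tautProg_pc105 : tautProg[105]? = some (.goto 111) := rfl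
/-- fetch at `106` (KBm1). [folklore] -/
@[simp] theorem tautProg_pc106 : tautProg[106]? = some (.pop 6 107 109 116) := rfl
/-- fetch at `107` (KBm1T). [folklore] -/
@[simp] theorem tautProg_pc107 : tautProg[107]? = some (.push 5 true) := rfl
/-- fetch at `108`. [folklore] -/
@[simp] theorem tautProg_pc108 : tautProg[108]? = some (.goto 91) := rfl
/-- fetch at `109` (KBm1F). [folklore] -/
@[simp] theorem tautProg_pc109 : tautProg[109]? = some (.push 5 false) := rfl
/-- fetch at `110`. [folklore] -/
@[simp] theorem tautProg_pc110 : tautProg[110]? = some (.goto 116) := rfl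
/-- fetch at `111` (KBm0). [folklore] -/
@[simp] theorem tautProg_pc111 : tautProg[111]? = some (.pop 6 112 114 116) := rfl
/-- fetch at `112` (KBm0T). [folklore] -/
@[simp] theorem tautProg_pc112 : tautProg[112]? = some (.push 5 true) := rfl
/-- fetch at `113`. [folklore] -/
@[simp] theorem tautProg_pc113 : tautProg[113]? = some (.goto 116) := rfl
/-- fetch at `114` (KBm0F). [folklore] -/
@[simp] theorem tautProg_pc114 : tautProg[114]? = some (.push 5 false) := rfl
/-- fetch at `115`. [folklore] -/
@[simp] theorem tautProg_pc115 : tautProg[115]? = some (.goto 91) := rfl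
/-- fetch at `116` (K0n). [folklore] -/
@[simp] theorem tautProg_pc116 : tautProg[116]? = some (.pop 10 117 119 151) := rfl
/-- fetch at `117` (K0nT). [folklore] -/
@[simp] theorem tautProg_pc117 : tautProg[117]? = some (.push 7 true) := rfl
/-- fetch at `118`. [folklore] -/
@[simp] theorem tautProg_pc118 : tautProg[118]? = some (.goto 121) := rfl
/-- fetch at `119` (K0nF). [folklore] -/
@[simp] theorem tautProg_pc119 : tautProg[119]? = some (.push 7 false) := rfl
/-- fetch at `120`. [folklore] -/
@[simp] theorem tautProg_pc120 : tautProg[120]? = some (.goto 126) := rfl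
/-- fetch at `121` (K1nt). [folklore] -/
@[simp] theorem tautProg_pc121 : tautProg[121]? = some (.pop 10 122 124 151) := rfl
/-- fetch at `122` (K1ntT). [folklore] -/
@[simp] theorem tautProg_pc122 : tautProg[122]? = some (.push 7 true) := rfl
/-- fetch at `123`. [folklore] -/
@[simp] theorem tautProg_pc123 : tautProg[123]? = some (.goto 116) := rfl
/-- fetch at `124` (K1ntF). [folklore] -/
@[simp] theorem tautProg_pc124 : tautProg[124]? = some (.push 7 false) := rfl
/-- fetch at `125`. [folklore] -/
@[simp] theorem tautProg_pc125 : tautProg[125]? = some (.goto 151) := rfl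
/-- fetch at `126` (K1nf). [folklore] -/
@[simp] theorem tautProg_pc126 : tautProg[126]? = some (.pop 10 127 129 151) := rfl
/-- fetch at `127` (K1nfT). [folklore] -/
@[simp] theorem tautProg_pc127 : tautProg[127]? = some (.push 7 true) := rfl
/-- fetch at `128`. [folklore] -/
@[simp] theorem tautProg_pc128 : tautProg[128]? = some (.goto 141) := rfl
/-- fetch at `129` (K1nfF). [folklore] -/
@[simp] theorem tautProg_pc129 : tautProg[129]? = some (.push 7 false) := rfl
/-- fetch at `130`. [folklore] -/
@[simp] theorem tautProg_pc130 : tautProg[130]? = some (.goto 116) := rfl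
/-- fetch at `131` (KENDm). [folklore] -/
@[simp] theorem tautProg_pc131 : tautProg[131]? = some (.pop 6 132 134 136) := rfl
/-- fetch at `132` (KEt). [folklore] -/
@[simp] theorem tautProg_pc132 : tautProg[132]? = some (.push 6 true) := rfl
/-- fetch at `133`. [folklore] -/
@[simp] theorem tautProg_pc133 : tautProg[133]? = some (.goto 141) := rfl
/-- fetch at `134` (KEf). [folklore] -/
@[simp] theorem tautProg_pc134 : tautProg[134]? = some (.push 6 false) := rfl
/-- fetch at `135`. [folklore] -/
@[simp] theorem tautProg_pc135 : tautProg[135]? = some (.goto 141) := rfl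
/-- fetch at `136` (KVm). [folklore] -/
@[simp] theorem tautProg_pc136 : tautProg[136]? = some (.pop 10 137 139 151) := rfl
/-- fetch at `137` (KVmT). [folklore] -/
@[simp] theorem tautProg_pc137 : tautProg[137]? = some (.push 7 true) := rfl
/-- fetch at `138`. [folklore] -/
@[simp] theorem tautProg_pc138 : tautProg[138]? = some (.goto 152) := rfl
/-- fetch at `139` (KVmF). [folklore] -/
@[simp] theorem tautProg_pc139 : tautProg[139]? = some (.push 7 false) := rfl
/-- fetch at `140`. [folklore] -/
@[simp] theorem tautProg_pc140 : tautProg[140]? = some (.goto 154) := rfl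
/-- fetch at `141` (KVn). [folklore] -/
@[simp] theorem tautProg_pc141 : tautProg[141]? = some (.pop 10 142 144 151) := rfl
/-- fetch at `142` (KVnT). [folklore] -/
@[simp] theorem tautProg_pc142 : tautProg[142]? = some (.push 7 true) := rfl
/-- fetch at `143`. [folklore] -/
@[simp] theorem tautProg_pc143 : tautProg[143]? = some (.goto 146) := rfl
/-- fetch at `144` (KVnF). [folklore] -/
@[simp] theorem tautProg_pc144 : tautProg[144]? = some (.push 7 false) := rfl
/-- fetch at `145`. [folklore] -/
@[simp] theorem tautProg_pc145 : tautProg[145]? = some (.goto 146) := rfl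
/-- fetch at `146` (QR). [folklore] -/
@[simp] theorem tautProg_pc146 : tautProg[146]? = some (.pop 5 147 149 91) := rfl
/-- fetch at `147` (QRt). [folklore] -/
@[simp] theorem tautProg_pc147 : tautProg[147]? = some (.push 6 true) := rfl
/-- fetch at `148`. [folklore] -/
@[simp] theorem tautProg_pc148 : tautProg[148]? = some (.goto 146) := rfl
/-- fetch at `149` (QRf). [folklore] -/
@[simp] theorem tautProg_pc149 : tautProg[149]? = some (.push 6 false) := rfl
/-- fetch at `150`. [folklore] -/
@[simp] theorem tautProg_pc150 : tautProg[150]? = some (.goto 146) := rfl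
/-- fetch at `151` (LFAIL). [folklore] -/
@[simp] theorem tautProg_pc151 : tautProg[151]? = some (.goto 154) := rfl
/-- fetch at `152` (RESt). [folklore] -/
@[simp] theorem tautProg_pc152 : tautProg[152]? = some (.push 8 true) := rfl
/-- fetch at `153`. [folklore] -/
@[simp] theorem tautProg_pc153 : tautProg[153]? = some (.goto 156) := rfl
/-- fetch at `154` (RESf). [folklore] -/
@[simp] theorem tautProg_pc154 : tautProg[154]? = some (.push 8 false) := rfl
/-- fetch at `155`. [folklore] -/
@[simp] theorem tautProg_pc155 : tautProg[155]? = some (.goto 156) := rfl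
/-- fetch at `156` (RY). [folklore] -/
@[simp] theorem tautProg_pc156 : tautProg[156]? = some (.pop 7 157 159 161) := rfl
/-- fetch at `157` (RYt). [folklore] -/
@[simp] theorem tautProg_pc157 : tautProg[157]? = some (.push 10 true) := rfl
/-- fetch at `158`. [folklore] -/
@[simp] theorem tautProg_pc158 : tautProg[158]? = some (.goto 156) := rfl
/-- fetch at `159` (RYf). [folklore] -/
@[simp] theorem tautProg_pc159 : tautProg[159]? = some (.push 10 false) := rfl
/-- fetch at `160`. [folklore] -/
@[simp] theorem tautProg_pc160 : tautProg[160]? = some (.goto 156) := rfl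
/-- fetch at `161` (CQ). [folklore] -/
@[simp] theorem tautProg_pc161 : tautProg[161]? = some (.pop 5 161 161 162) := rfl
/-- fetch at `162` (CQ2). [folklore] -/
@[simp] theorem tautProg_pc162 : tautProg[162]? = some (.pop 6 162 162 64) := rfl
/-- fetch at `163` (E0). [folklore] -/
@[simp] theorem tautProg_pc163 : tautProg[163]? = some (.pop 8 164 165 165) := rfl
/-- fetch at `164` (E1t). [folklore] -/
@[simp] theorem tautProg_pc164 : tautProg[164]? = some (.pop 8 165 165 167) := rfl
/-- fetch at `165` (ACC). [folklore] -/
@[simp] theorem tautProg_pc165 : tautProg[165]? = some (.push 9 true) := rfl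
/-- fetch at `166`. [folklore] -/
@[simp] theorem tautProg_pc166 : tautProg[166]? = some (.goto 169) := rfl
/-- fetch at `167` (REJ). [folklore] -/
@[simp] theorem tautProg_pc167 : tautProg[167]? = some (.push 9 false) := rfl
/-- fetch at `168`. [folklore] -/
@[simp] theorem tautProg_pc168 : tautProg[168]? = some (.goto 169) := rfl
/-- fetch at `169` (HALT): no instruction. [folklore] -/
@[simp] theorem tautProg_pc169 : tautProg[169]? = none := by simp [tautProg_length]
end Fetch



/-! ### One step of the program on a register file -/

/-- **Symbolic execution.** One step from a configuration in register-file form: fetch the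
instruction (the `@[simp]` lemmas `tautProg_pc*`), then push / jump / pop on the register
(`mk_*`, `update_mk_*`). With this as a `simp` lemma, `simp` runs the program on
configurations `⟨pc, mk R⟩` with a numeral `pc` (and leaves other configurations alone).
[Minsky 1967, §11.1] [folklore] -/
@[simp] theorem step_mk (pc : ℕ) (R : RegFile) :
    tautProg.step ⟨pc, mk R⟩ =
      (match tautProg[pc]? with
        | none => ⟨pc, mk R⟩
        | some (.push k b) => ⟨pc + 1, Function.update (mk R) k (b :: mk R k)⟩
        | some (.goto j) => ⟨j, mk R⟩
        | some (.pop k jt jf jn) =>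
          match mk R k with
          | [] => ⟨jn, mk R⟩
          | true :: w => ⟨jt, Function.update (mk R) k w⟩
          | false :: w => ⟨jf, Function.update (mk R) k w⟩) := by
  show SProg.step tautProg _ = _
  unfold SProg.step
  dsimp only
  split <;> rename_i h
  · rw [h]
  · rw [h]
  · rw [h]
  · rw [h]; dsimp only
    split <;> rename_i h' <;> rw [h']

/-! ### Running the program: generic bookkeeping -/

/-- Run `a` steps, then `b` more. [folklore] -/
theorem steps_add (a b : ℕ) (c : SCfg 11) :
    tautProg.step^[a + b] c = tautProg.step^[b] (tautProg.step^[a] c) := by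
  rw [Nat.add_comm, Function.iterate_add_apply]

/-- `Reach c c' N`: the program drives `c` to `c'` in at most `N` steps. [folklore] -/
def Reach (c c' : SCfg 11) (N : ℕ) : Prop :=
  ∃ n ≤ N, tautProg.step^[n] c = c'

/-- An exact run is a run within its length. [folklore] -/
theorem Reach.of_eq {c c' : SCfg 11} {n : ℕ} (h : tautProg.step^[n] c = c') : Reach c c' n :=
  ⟨n, le_rfl, h⟩

/-- The empty run. [folklore] -/
theorem Reach.refl (c : SCfg 11) : Reach c c 0 := ⟨0, le_rfl, rfl⟩

/-- Weakening the step bound. [folklore] -/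
theorem Reach.mono {c c' : SCfg 11} {N N' : ℕ} (h : Reach c c' N) (hN : N ≤ N') : Reach c c' N' := by
  obtain ⟨n, hn, e⟩ := h; exact ⟨n, hn.trans hN, e⟩

/-- Composing runs (the bounds add). [folklore] -/
theorem Reach.trans {c₁ c₂ c₃ : SCfg 11} {N₁ N₂ : ℕ} (h₁ : Reach c₁ c₂ N₁) (h₂ : Reach c₂ c₃ N₂) :
    Reach c₁ c₃ (N₁ + N₂) := by
  obtain ⟨n₁, hn₁, e₁⟩ := h₁
  obtain ⟨n₂, hn₂, e₂⟩ := h₂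
  exact ⟨n₁ + n₂, Nat.add_le_add hn₁ hn₂, by rw [steps_add, e₁, e₂]⟩

/-- A halted configuration (`pc = 169`) is fixed. [folklore] -/
theorem step_halt (rg : Fin 11 → List Bool) : tautProg.step ⟨169, rg⟩ = ⟨169, rg⟩ :=
  tautProg.step_of_le (by simp [tautProg_length])

/-- Hence all iterates of a halted configuration are fixed. [folklore] -/
theorem iterate_halt (rg : Fin 11 → List Bool) (m : ℕ) : tautProg.step^[m] ⟨169, rg⟩ = ⟨169, rg⟩ :=
  tautProg.iterate_step_of_le (by simp [tautProg_length]) m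

/-- Once halted within `N` steps, the configuration after any `m ≥ N` steps is the halted one.
[folklore] -/
theorem Reach.iterate_of_le {c : SCfg 11} {rg : Fin 11 → List Bool} {N m : ℕ}
    (h : Reach c ⟨169, rg⟩ N) (hm : N ≤ m) : tautProg.step^[m] c = ⟨169, rg⟩ := by
  obtain ⟨n, hn, e⟩ := h
  obtain ⟨d, rfl⟩ := Nat.exists_eq_add_of_le (hn.trans hm)
  rw [steps_add, e, iterate_halt]

/-- `Halts c b N`: from `c` the program halts within `N` steps with output register `[b]`
(whatever the other registers). [folklore] -/
def Halts (c : SCfg 11) (b : Bool) (N : ℕ) : Prop :=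
  ∃ R' : RegFile, R'.out = [b] ∧ Reach c ⟨169, mk R'⟩ N

/-- Weakening the step bound. [folklore] -/
theorem Halts.mono {c : SCfg 11} {b : Bool} {N N' : ℕ} (h : Halts c b N) (hN : N ≤ N') : Halts c b N' := by
  obtain ⟨R', ho, hr⟩ := h; exact ⟨R', ho, hr.mono hN⟩

/-- Prefixing a halting run by a run. [folklore] -/
theorem Halts.of_reach {c c' : SCfg 11} {b : Bool} {N₁ N₂ : ℕ} (h₁ : Reach c c' N₁) (h₂ : Halts c' b N₂) :
    Halts c b (N₁ + N₂) := by
  obtain ⟨R', ho, hr⟩ := h₂; exact ⟨R', ho, h₁.trans hr⟩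

/-- The output register after enough steps. [folklore] -/
theorem Halts.regs_out {c : SCfg 11} {b : Bool} {N m : ℕ} (h : Halts c b N) (hm : N ≤ m) :
    (tautProg.step^[m] c).regs 9 = [b] := by
  obtain ⟨R', ho, hr⟩ := h
  rw [hr.iterate_of_le hm]; simpa using ho

/-- `ACC`: accept and halt (2 steps). [folklore] -/
theorem halts_ACC (R : RegFile) (hR : R.out = []) : Halts ⟨165, mk R⟩ true 2 := by
  obtain ⟨w, w2, u, t, s, q, q2, y2, v, out, inp⟩ := R
  cases hR
  exact ⟨⟨w, w2, u, t, s, q, q2, y2, v, [true], inp⟩, rfl, Reach.of_eq (by simp)⟩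

/-- `REJ`: reject and halt (2 steps). [folklore] -/
theorem halts_REJ (R : RegFile) (hR : R.out = []) : Halts ⟨167, mk R⟩ false 2 := by
  obtain ⟨w, w2, u, t, s, q, q2, y2, v, out, inp⟩ := R
  cases hR
  exact ⟨⟨w, w2, u, t, s, q, q2, y2, v, [false], inp⟩, rfl, Reach.of_eq (by simp)⟩

/-! ### Phase A: splitting the input pair -/

/-- The reading of `z = ⟨w, y⟩` performed by phase A: pairs `bb` push `b` (so the instance is
collected reversed), the pair `01` ends the first component; anything else is malformed.
[Arora–Barak 2009, §0.1] [folklore] -/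
def unpairA : List Bool → List Bool → Option (List Bool × List Bool)
  | acc, true :: true :: r => unpairA (true :: acc) r
  | acc, false :: false :: r => unpairA (false :: acc) r
  | acc, false :: true :: r => some (acc, r)
  | _, _ => none

/-- Phase A's reading of a genuine pair `⟨w, y⟩`: the instance reversed, then `y`. [folklore] -/
theorem unpairA_boolPair (acc w y : List Bool) : unpairA acc (boolPair w y) = some (w.reverse ++ acc, y) := by
  induction w generalizing acc with
  | nil => simp [boolPair, unpairA]
  | cons b w ih =>
    have : boolPair (b :: w) y = b :: b :: boolPair w y := by simp [boolPair]
    rw [this]; cases b <;> simp [unpairA, ih]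

/-- Phase A, success: from `A0` with `z` in `inp`, if `unpairA acc z = some (wr, y)` the program
reaches the pouring loop `P0` with `wr` in `w` and `y` in `inp`. [folklore] -/
theorem phaseA_some (R : RegFile) : ∀ (acc z wr y : List Bool), unpairA acc z = some (wr, y) →
    Reach ⟨0, mk { R with w := acc, inp := z }⟩ ⟨7, mk { R with w := wr, inp := y }⟩ (4 * z.length)
  | acc, true :: true :: r, wr, y, h => by
    rw [unpairA] at h
    have ih := phaseA_some R (true :: acc) r wr y h
    refine (Reach.trans (N₁ := 4) (Reach.of_eq ?_) ih).mono (by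
      simp only [List.length_cons,
        ] at * ; omega)
    simp
  | acc, false :: false :: r, wr, y, h => by
    rw [unpairA] at h
    have ih := phaseA_some R (false :: acc) r wr y h
    refine (Reach.trans (N₁ := 4) (Reach.of_eq ?_) ih).mono (by
      simp only [List.length_cons,
        ] at * ; omega)
    simp
  | acc, false :: true :: r, wr, y, h => by
    simp [unpairA] at h
    obtain ⟨rfl, rfl⟩ := h
    refine (Reach.of_eq (n := 2) ?_).mono (by
      simp only [List.length_cons,
        ] at * ; omega)
    simp
  | acc, [], wr, y, h => by simp [unpairA] at h
  | acc, [true], wr, y, h => by simp [unpairA] at h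
  | acc, [false], wr, y, h => by simp [unpairA] at h
  | acc, true :: false :: r, wr, y, h => by simp [unpairA] at h

/-- Phase A, failure: a malformed input is rejected. [folklore] -/
theorem phaseA_none (R : RegFile) (hR : R.out = []) : ∀ (acc z : List Bool), unpairA acc z = none →
    Halts ⟨0, mk { R with w := acc, inp := z }⟩ false (4 * z.length + 4)
  | acc, true :: true :: r, h => by
    rw [unpairA] at h
    have ih := phaseA_none R hR (true :: acc) r h
    refine (Halts.of_reach (N₁ := 4) (Reach.of_eq ?_) ih).mono (by
      simp only [List.length_cons,
        ] at * ; omega)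
    simp
  | acc, false :: false :: r, h => by
    rw [unpairA] at h
    have ih := phaseA_none R hR (false :: acc) r h
    refine (Halts.of_reach (N₁ := 4) (Reach.of_eq ?_) ih).mono (by
      simp only [List.length_cons,
        ] at * ; omega)
    simp
  | acc, false :: true :: r, h => by simp [unpairA] at h
  | acc, [], _ => by
    refine (Halts.of_reach (N₁ := 1) (Reach.of_eq ?_) (halts_REJ { R with w := acc, inp := [] } hR)).mono (by
      simp only [List.length_nil,
        ] at * ; omega)
    simp
  | acc, [true], _ => by
    refine (Halts.of_reach (N₁ := 2) (Reach.of_eq ?_) (halts_REJ { R with w := acc, inp := [] } hR)).mono (by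
      simp only [List.length_cons, List.length_nil,
        ] at * ; omega)
    simp
  | acc, [false], _ => by
    refine (Halts.of_reach (N₁ := 2) (Reach.of_eq ?_) (halts_REJ { R with w := acc, inp := [] } hR)).mono (by
      simp only [List.length_cons, List.length_nil,
        ] at * ; omega)
    simp
  | acc, true :: false :: r, _ => by
    refine (Halts.of_reach (N₁ := 2) (Reach.of_eq ?_) (halts_REJ { R with w := acc, inp := r } hR)).mono (by
      simp only [List.length_cons,
        ] at * ; omega)
    simp

/-! ### Pouring `w` onto `w2` -/

/-- The pouring loop `P0`: `w` is moved, reversed, on top of `w2` in `3|w| + 1` steps. [folklore] -/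
theorem pour_w (R : RegFile) : ∀ (a : List Bool),
    tautProg.step^[3 * a.length + 1] ⟨7, mk { R with w := a }⟩ =
      ⟨12, mk { R with w := [], w2 := a.reverse ++ R.w2 }⟩ := by
  intro a
  induction a generalizing R with
  | nil => cases R; simp
  | cons b a ih =>
    rw [show 3 * (b :: a).length + 1 = 3 + (3 * a.length + 1) by simp; ring, steps_add]
    have := ih { R with w2 := b :: R.w2 }
    cases b <;> simpa using this


/-! ### Phase B: the unary size header (`readHdr`) -/

/-- Program counter of the header reader in state `p` (pending first bit of a pair). [folklore] -/
def pcB : Option Bool → ℕ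
  | none => 12
  | some true => 13
  | some false => 16

/-- Phase B, success: `readHdr s p r = some (s', c)` drives `⟨B(p), u = 1ˢ, w2 = r⟩` to the
tokenizer start `C0` with `u = 1^{s'}` and `w2 = c`. [folklore] -/
theorem phaseB_some (R : RegFile) : ∀ (s : ℕ) (p : Option Bool) (r : List Bool) (s' : ℕ) (c : List Bool),
    readHdr s p r = some (s', c) →
    Reach ⟨pcB p, mk { R with w2 := r, u := List.replicate s true }⟩
      ⟨17, mk { R with w2 := c, u := List.replicate s' true }⟩ (3 * r.length) := by
  intro s p r
  induction s, p, r using readHdr.induct with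
  | case1 s b r ih =>
    intro s' c h
    rw [readHdr] at h
    refine ((Reach.of_eq (n := 1) ?_).trans (ih s' c h)).mono (by
      simp only [List.length_cons,
        ] at * ; omega)
    cases b <;> simp [pcB]
  | case2 s r ih =>
    intro s' c h
    rw [readHdr] at h
    refine ((Reach.of_eq (n := 3) ?_).trans (ih s' c h)).mono (by
      simp only [List.length_cons,
        ] at * ; omega)
    simp [pcB, List.replicate_succ]
  | case3 s r =>
    intro s' c h
    simp only [readHdr, Option.some.injEq, Prod.mk.injEq] at h
    obtain ⟨rfl, rfl⟩ := h
    refine (Reach.of_eq (n := 1) ?_).mono (by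
      simp only [List.length_cons,
        ] at * ; omega)
    simp [pcB]
  | case4 s b r => intro s' c h; simp [readHdr] at h
  | case5 s p => intro s' c h; simp [readHdr] at h

/-- Phase B, failure: `readHdr s p r = none` (not a codeword) is accepted. [folklore] -/
theorem phaseB_none (R : RegFile) (hR : R.out = []) : ∀ (s : ℕ) (p : Option Bool) (r : List Bool),
    readHdr s p r = none →
    Halts ⟨pcB p, mk { R with w2 := r, u := List.replicate s true }⟩ true (3 * r.length + 3) := by
  intro s p r
  induction s, p, r using readHdr.induct with
  | case1 s b r ih =>
    intro h
    rw [readHdr] at h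
    refine (Halts.of_reach (N₁ := 1) (Reach.of_eq ?_) (ih h)).mono (by
      simp only [List.length_cons,
        ] at * ; omega)
    cases b <;> simp [pcB]
  | case2 s r ih =>
    intro h
    rw [readHdr] at h
    refine (Halts.of_reach (N₁ := 3) (Reach.of_eq ?_) (ih h)).mono (by
      simp only [List.length_cons,
        ] at * ; omega)
    simp [pcB, List.replicate_succ]
  | case3 s r => intro h; simp [readHdr] at h
  | case4 s b r =>
    intro _
    refine (Halts.of_reach (N₁ := 1) (Reach.of_eq ?_)
      (halts_ACC { R with w2 := r, u := List.replicate s true } hR)).mono (by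
      simp only [List.length_cons,
        ] at * ; omega)
    cases b <;> simp [pcB]
  | case5 s p =>
    intro _
    refine (Halts.of_reach (N₁ := 1) (Reach.of_eq ?_)
      (halts_ACC { R with w2 := [], u := List.replicate s true } hR)).mono (by
      simp only [List.length_nil,
        ] at * ; omega)
    rcases p with _ | _ | _ <;> simp [pcB]

/-! ### Phase C: the tokenizer (`tokRun`) -/

/-- The code of a token on the token stack `s`, top first (the order in which phase D reads
it): `0 0 b` for a constant, `1 0` / `1 1 0` / `1 1 1` for `¬`/`∧`/`∨`, and
`0 1 (1 p₁) ⋯ (1 p_k) 0` for a variable with payload `p₁ ⋯ p_k`. [folklore] -/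
def tokCode : FTok → List Bool
  | .const b => [false, false, b]
  | .neg => [true, false]
  | .conj => [true, true, false]
  | .disj => [true, true, true]
  | .var bs => false :: true :: (bs.flatMap fun b => [true, b]) ++ [false]

/-- The payload part of a variable's stack code: pairs `(1, pᵢ)`. [folklore] -/
def pbits (bs : List Bool) : List Bool := bs.flatMap fun b => [true, b]

/-- `pbits [] = []`. [folklore] -/
@[simp] theorem pbits_nil : pbits [] = [] := rfl
/-- `pbits (b :: bs) = 1 b (pbits bs)`. [folklore] -/
@[simp] theorem pbits_cons (b : Bool) (bs : List Bool) : pbits (b :: bs) = true :: b :: pbits bs := rfl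
/-- `pbits` of a concatenation. [folklore] -/
@[simp] theorem pbits_append (bs bs' : List Bool) : pbits (bs ++ bs') = pbits bs ++ pbits bs' := by
  simp [pbits]

/-- The code of a variable token, via `pbits`. [folklore] -/
theorem tokCode_var (bs : List Bool) : tokCode (.var bs) = false :: true :: (pbits bs ++ [false]) := rfl

/-- The token stack of a token string: the codes of the tokens, last token on top. [folklore] -/
def rcode (ts : List FTok) : List Bool := (ts.reverse).flatMap tokCode

/-- `rcode [] = []`. [folklore] -/
@[simp] theorem rcode_nil : rcode [] = [] := rfl

/-- `rcode (t :: ts) = rcode ts ++ tokCode t`. [folklore] -/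
@[simp] theorem rcode_cons (t : FTok) (ts : List FTok) : rcode (t :: ts) = rcode ts ++ tokCode t := by
  simp [rcode]

/-- Program counter of the tokenizer in state `st` with payload `acc` (the payload states are
split by the canonicity of the payload read so far). [folklore] -/
def pcC : TkSt → List Bool → ℕ
  | .start, _ => 17
  | .t0, _ => 18
  | .t1, _ => 28
  | .t11, _ => 32
  | .cst, _ => 19
  | .pay0, acc => if IsCanonicalNum acc then 42 else 43
  | .pay1 true, _ => 44
  | .pay1 false, acc => if IsCanonicalNum acc then 47 else 48

/-- The payload register in state `st`: the payload read so far, last bit on top (empty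
outside payloads). [folklore] -/
def accC : TkSt → List Bool → List Bool
  | .pay0, acc => acc.reverse
  | .pay1 _, acc => acc.reverse
  | _, _ => []

/-- The tokenizer configuration for `(st, acc)` on unread input `r`, budget `k`, token stack `S`.
[folklore] -/
def cfgC (R : RegFile) (st : TkSt) (acc r : List Bool) (k : ℕ) (S : List Bool) : SCfg 11 :=
  ⟨pcC st acc, mk { R with w2 := r, u := List.replicate k true, t := accC st acc, s := S }⟩

/-- The end-of-code configuration `CE` with remaining budget `k` and token stack `S`. [folklore] -/
def cfgCE (R : RegFile) (k : ℕ) (S : List Bool) : SCfg 11 :=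
  ⟨63, mk { R with w2 := [], u := List.replicate k true, t := [], s := S }⟩

/-- Step budget of the tokenizer: per input bit, plus the deferred cost of draining a payload.
[folklore] -/
def bdC (n a : ℕ) : ℕ := 10 * n + 4 * a + 3

/-- The outcome of the tokenizer from a configuration `c` with budget `k`, according to the
result of `tokRun`: failure is accepted; on success with at most `k` tokens the end-of-code
configuration is reached with the budget decreased by the number of tokens and their codes
pushed; more than `k` tokens are accepted (size mismatch). [folklore] -/
def COut (R : RegFile) (res : Option (List FTok)) (c : SCfg 11) (k : ℕ) (S : List Bool) (N : ℕ) : Prop :=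
  match res with
  | none => Halts c true N
  | some ts => (ts.length ≤ k → Reach c (cfgCE R (k - ts.length) (rcode ts ++ S)) N) ∧
      (k < ts.length → Halts c true N)

/-- Weakening the step bound of an outcome. [folklore] -/
theorem COut.mono {R : RegFile} {res : Option (List FTok)} {c : SCfg 11} {k : ℕ} {S : List Bool}
    {N N' : ℕ} (h : COut R res c k S N) (hN : N ≤ N') : COut R res c k S N' := by
  cases res with
  | none => exact Halts.mono h hN
  | some ts => exact ⟨fun hk => (h.1 hk).mono hN, fun hk => (h.2 hk).mono hN⟩

/-- Prefixing an outcome by a computation. [folklore] -/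
theorem COut.of_reach {R : RegFile} {res : Option (List FTok)} {c c' : SCfg 11} {k : ℕ} {S : List Bool}
    {N₁ N₂ : ℕ} (h₁ : Reach c c' N₁) (h₂ : COut R res c' k S N₂) : COut R res c k S (N₁ + N₂) := by
  cases res with
  | none => exact Halts.of_reach h₁ h₂
  | some ts => exact ⟨fun hk => h₁.trans (h₂.1 hk), fun hk => Halts.of_reach h₁ (h₂.2 hk)⟩

/-- Emitting a token `t` and counting it against the budget: from the counting instruction
`CNT` with the code of `t` pushed, budget `0` accepts, budget `k + 1` continues as the outcome
of the rest with budget `k`. [folklore] -/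
theorem COut.emit {R : RegFile} (hR : R.out = []) {res : Option (List FTok)} (t : FTok) {k : ℕ}
    {S r : List Bool} {N : ℕ}
    (h : ∀ k', k = k' + 1 → COut R res (cfgC R .start [] r k' (tokCode t ++ S)) k' (tokCode t ++ S) N) :
    COut R (res.map (t :: ·))
      ⟨41, mk { R with w2 := r, u := List.replicate k true, t := [], s := tokCode t ++ S }⟩ k S
      (N + 3) := by
  cases k with
  | zero =>
    have hacc : Halts
        ⟨41, mk { R with w2 := r, u := List.replicate 0 true, t := [], s := tokCode t ++ S }⟩
        true (N + 3) := by
      refine (Halts.of_reach (N₁ := 1) (Reach.of_eq ?_)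
        (halts_ACC { R with w2 := r, u := [], t := [], s := tokCode t ++ S } hR)).mono (by omega)
      simp
    cases res with
    | none => exact hacc
    | some ts => exact ⟨fun hk => absurd hk (by simp), fun _ => hacc⟩
  | succ k' =>
    have h1 : Reach
        ⟨41, mk { R with w2 := r, u := List.replicate (k' + 1) true, t := [], s := tokCode t ++ S }⟩
        (cfgC R .start [] r k' (tokCode t ++ S)) 1 :=
      Reach.of_eq (by simp [cfgC, pcC, accC, List.replicate_succ])
    have h2 := COut.of_reach h1 (h k' rfl)
    cases res with
    | none => exact Halts.mono h2 (by omega)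
    | some ts =>
      refine ⟨fun hk => ?_, fun hk => ?_⟩
      · have hk' : ts.length ≤ k' := by simp at hk; omega
        have h3 := h2.1 hk'
        have e1 : k' + 1 - (t :: ts).length = k' - ts.length := by simp
        have e2 : rcode (t :: ts) ++ S = rcode ts ++ (tokCode t ++ S) := by simp
        rw [e1, e2]; exact h3.mono (by omega)
      · exact (h2.2 (by simp at hk; omega)).mono (by omega)

/-- `[]` is a canonical numeral. [folklore] -/
@[simp] theorem isCanonicalNum_nil : IsCanonicalNum [] := Or.inl rfl

/-- Appending a `1` gives a canonical numeral. [folklore] -/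
@[simp] theorem isCanonicalNum_append_true (acc : List Bool) : IsCanonicalNum (acc ++ [true]) :=
  Or.inr (by simp)

/-- Appending a `0` never gives a canonical numeral. [folklore] -/
@[simp] theorem not_isCanonicalNum_append_false (acc : List Bool) : ¬IsCanonicalNum (acc ++ [false]) := by
  rintro (h | h) <;> simp at h

/-- The payload drain loop `CvL`: the payload register is moved onto the token stack as pairs
`(1, pᵢ)`, first payload bit on top. [folklore] -/
theorem drain (R : RegFile) : ∀ (l S : List Bool),
    tautProg.step^[4 * l.length] ⟨53, mk { R with t := l, s := S }⟩ =
      ⟨53, mk { R with t := [], s := (l.reverse.flatMap fun b => [true, b]) ++ S }⟩ := by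
  intro l
  induction l with
  | nil => intro S; simp
  | cons b l ih =>
    intro S
    rw [show 4 * (b :: l).length = 4 + 4 * l.length by simp; ring, steps_add]
    have h4 : tautProg.step^[4] ⟨53, mk { R with t := b :: l, s := S }⟩ =
        ⟨53, mk { R with t := l, s := true :: b :: S }⟩ := by
      cases b <;> simp
    rw [h4, ih]
    simp [List.flatMap_append]

/-- Outside the start state the input may not end. [folklore] -/
theorem tokRun_nil_of_ne {st : TkSt} (h : st ≠ .start) (acc : List Bool) : tokRun st acc [] = none := by
  cases st with
  | start => exact absurd rfl h
  | pay1 b => cases b <;> rfl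
  | _ => rfl

/-- **Phase C simulates the tokenizer** `tokRun` (all states, payloads, inputs, budgets and
token stacks), with the outcome `COut`. [folklore] -/
theorem phaseC (R : RegFile) (hR : R.out = []) : ∀ (st : TkSt) (acc r : List Bool) (k : ℕ) (S : List Bool),
    COut R (tokRun st acc r) (cfgC R st acc r k S) k S (bdC r.length (accC st acc).length) := by
  intro st acc r
  induction st, acc, r using tokRun.induct with
  | case1 acc =>
    intro k S
    rw [tokRun]
    refine ⟨fun _ => ?_, fun hk => absurd hk (by simp)⟩
    refine (Reach.of_eq (n := 1) ?_).mono (by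
      simp only [bdC, accC, List.length_nil] ;
        omega)
    simp [cfgC, cfgCE, pcC, accC]
  | case2 acc r ih =>
    intro k S
    rw [tokRun]
    refine (COut.of_reach (N₁ := 1) (Reach.of_eq ?_) (ih k S)).mono (by
      simp only [bdC, accC, List.length_cons, List.length_nil] ;
        omega)
    simp [cfgC, pcC, accC]
  | case3 acc r ih =>
    intro k S
    rw [tokRun]
    refine (COut.of_reach (N₁ := 1) (Reach.of_eq ?_) (ih k S)).mono (by
      simp only [bdC, accC, List.length_cons, List.length_nil] ;
        omega)
    simp [cfgC, pcC, accC]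
  | case4 acc r ih =>
    intro k S
    rw [tokRun]
    refine (COut.of_reach (N₁ := 1) (Reach.of_eq ?_) (ih k S)).mono (by
      simp only [bdC, accC, List.length_cons, List.length_nil, List.length_reverse] ;
        omega)
    simp [cfgC, pcC, accC]
  | case5 acc r ih =>
    intro k S
    rw [tokRun]
    refine (COut.of_reach (N₁ := 1) (Reach.of_eq ?_) (ih k S)).mono (by
      simp only [bdC, accC, List.length_cons, List.length_nil] ;
        omega)
    simp [cfgC, pcC, accC]
  | case6 acc b r ih =>
    intro k S
    rw [tokRun]
    have h1 : Reach (cfgC R .cst acc (b :: r) k S)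
        ⟨41, mk { R with w2 := r, u := List.replicate k true, t := [], s := tokCode (.const b) ++ S }⟩ 5 :=
      Reach.of_eq (by cases b <;> simp [cfgC, pcC, accC, tokCode])
    exact (COut.of_reach h1 (COut.emit hR (.const b)
      (fun k' _ => ih k' (tokCode (.const b) ++ S)))).mono (by
      simp only [bdC, accC, List.length_cons, List.length_nil] ;
        omega)
  | case7 acc r ih =>
    intro k S
    rw [tokRun]
    have h1 : Reach (cfgC R .t1 acc (false :: r) k S)
        ⟨41, mk { R with w2 := r, u := List.replicate k true, t := [], s := tokCode .neg ++ S }⟩ 4 :=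
      Reach.of_eq (by simp [cfgC, pcC, accC, tokCode])
    exact (COut.of_reach h1 (COut.emit hR .neg
      (fun k' _ => ih k' (tokCode .neg ++ S)))).mono (by
      simp only [bdC, accC, List.length_cons, List.length_nil] ;
        omega)
  | case8 acc r ih =>
    intro k S
    rw [tokRun]
    refine (COut.of_reach (N₁ := 1) (Reach.of_eq ?_) (ih k S)).mono (by
      simp only [bdC, accC, List.length_cons, List.length_nil] ;
        omega)
    simp [cfgC, pcC, accC]
  | case9 acc r ih =>
    intro k S
    rw [tokRun]
    have h1 : Reach (cfgC R .t11 acc (false :: r) k S)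
        ⟨41, mk { R with w2 := r, u := List.replicate k true, t := [], s := tokCode .conj ++ S }⟩ 5 :=
      Reach.of_eq (by simp [cfgC, pcC, accC, tokCode])
    exact (COut.of_reach h1 (COut.emit hR .conj
      (fun k' _ => ih k' (tokCode .conj ++ S)))).mono (by
      simp only [bdC, accC, List.length_cons, List.length_nil] ;
        omega)
  | case10 acc r ih =>
    intro k S
    rw [tokRun]
    have h1 : Reach (cfgC R .t11 acc (true :: r) k S)
        ⟨41, mk { R with w2 := r, u := List.replicate k true, t := [], s := tokCode .disj ++ S }⟩ 5 :=
      Reach.of_eq (by simp [cfgC, pcC, accC, tokCode])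
    exact (COut.of_reach h1 (COut.emit hR .disj
      (fun k' _ => ih k' (tokCode .disj ++ S)))).mono (by
      simp only [bdC, accC, List.length_cons, List.length_nil] ;
        omega)
  | case11 acc b r ih =>
    intro k S
    rw [tokRun]
    refine (COut.of_reach (N₁ := 1) (Reach.of_eq ?_) (ih k S)).mono (by
      simp only [bdC, accC, List.length_cons, List.length_reverse] ;
        omega)
    by_cases hc : IsCanonicalNum acc <;> cases b <;> simp [cfgC, pcC, accC, hc]
  | case12 acc b r ih =>
    intro k S
    rw [tokRun, if_pos rfl]
    refine (COut.of_reach (N₁ := 3) (Reach.of_eq ?_) (ih k S)).mono (by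
      simp only [bdC, accC, List.length_cons, List.length_nil, List.length_reverse, List.length_append] ;
        omega)
    by_cases hc : IsCanonicalNum acc <;> cases b <;> simp [cfgC, pcC, accC, hc, List.reverse_append]
  | case13 b acc r hcan hb ih =>
    intro k S
    have hb' : b = false := by simpa using hb
    subst hb'
    rw [tokRun, if_neg hb, if_pos rfl, if_pos hcan]
    -- `Cp1fok` pops the `1`, `Cvar` pushes the end marker, the payload is drained, `CvE` closes
    have h1 : Reach (cfgC R (.pay1 false) acc (true :: r) k S)
        ⟨53, mk { R with w2 := r, u := List.replicate k true, t := acc.reverse, s := false :: S }⟩ 3 :=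
      Reach.of_eq (by simp [cfgC, pcC, accC, hcan])
    have h2 : Reach
        ⟨53, mk { R with w2 := r, u := List.replicate k true, t := acc.reverse, s := false :: S }⟩
        ⟨53, mk { R with w2 := r, u := List.replicate k true, t := [], s := pbits acc ++ false :: S }⟩
        (4 * acc.length) :=
      Reach.of_eq (by
        simpa [pbits] using drain { R with w2 := r, u := List.replicate k true } acc.reverse (false :: S))
    have h3 : Reach
        ⟨53, mk { R with w2 := r, u := List.replicate k true, t := [], s := pbits acc ++ false :: S }⟩
        ⟨41, mk { R with w2 := r, u := List.replicate k true, t := [], s := tokCode (.var acc) ++ S }⟩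
        4 :=
      Reach.of_eq (by simp [tokCode, pbits])
    exact (COut.of_reach ((h1.trans h2).trans h3) (COut.emit hR (.var acc)
      (fun k' _ => ih k' (tokCode (.var acc) ++ S)))).mono (by
      simp only [bdC, accC, List.length_cons, List.length_nil, List.length_reverse] ;
        omega)
  | case14 b acc r hcan hb =>
    intro k S
    have hb' : b = false := by simpa using hb
    subst hb'
    rw [tokRun, if_neg hb, if_pos rfl, if_neg hcan]
    refine (Halts.of_reach (N₁ := 1) (Reach.of_eq ?_)
      (halts_ACC { R with w2 := r, u := List.replicate k true, t := acc.reverse, s := S } hR)).mono (by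
      simp only [bdC, accC, List.length_cons, List.length_reverse] ;
        omega)
    simp [cfgC, pcC, accC, hcan]
  | case15 b acc b' r hbb hb' =>
    intro k S
    have e' : b' = false := by simpa using hb'
    subst e'
    have e : b = true := by cases b <;> simp_all
    subst e
    rw [tokRun, if_neg hbb, if_neg hb']
    refine (Halts.of_reach (N₁ := 1) (Reach.of_eq ?_)
      (halts_ACC { R with w2 := r, u := List.replicate k true, t := acc.reverse, s := S } hR)).mono (by
      simp only [bdC, accC, List.length_cons, List.length_reverse] ;
        omega)
    simp [cfgC, pcC, accC]
  | case16 st acc hst =>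
    intro k S
    rw [tokRun_nil_of_ne hst]
    have hacc : ∀ tt : List Bool, Halts ⟨165, mk { R with w2 := [], u := List.replicate k true, t := tt, s := S }⟩
        true 2 := fun tt => halts_ACC { R with w2 := [], u := List.replicate k true, t := tt, s := S } hR
    cases st with
    | start => exact absurd rfl hst
    | t0 =>
      refine (Halts.of_reach (N₁ := 1) (Reach.of_eq ?_) (hacc [])).mono (by
      simp only [bdC, accC, List.length_nil] ;
        omega)
      simp [cfgC, pcC, accC]
    | t1 =>
      refine (Halts.of_reach (N₁ := 1) (Reach.of_eq ?_) (hacc [])).mono (by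
      simp only [bdC, accC, List.length_nil] ;
        omega)
      simp [cfgC, pcC, accC]
    | t11 =>
      refine (Halts.of_reach (N₁ := 1) (Reach.of_eq ?_) (hacc [])).mono (by
      simp only [bdC, accC, List.length_nil] ;
        omega)
      simp [cfgC, pcC, accC]
    | cst =>
      refine (Halts.of_reach (N₁ := 1) (Reach.of_eq ?_) (hacc [])).mono (by
      simp only [bdC, accC, List.length_nil] ;
        omega)
      simp [cfgC, pcC, accC]
    | pay0 =>
      refine (Halts.of_reach (N₁ := 1) (Reach.of_eq ?_) (hacc acc.reverse)).mono (by
      simp only [bdC, accC, List.length_nil, List.length_reverse] ;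
        omega)
      by_cases hc : IsCanonicalNum acc <;> simp [cfgC, pcC, accC, hc]
    | pay1 b =>
      refine (Halts.of_reach (N₁ := 1) (Reach.of_eq ?_) (hacc acc.reverse)).mono (by
      simp only [bdC, accC, List.length_nil, List.length_reverse] ;
        omega)
      by_cases hc : IsCanonicalNum acc <;> cases b <;> simp [cfgC, pcC, accC, hc]

/-- The end of the code, `CE`: leftover budget (fewer tokens than announced) is accepted,
otherwise evaluation starts at `D0`. [folklore] -/
theorem phaseCE_pos (R : RegFile) (hR : R.out = []) (k : ℕ) (S : List Bool) (hk : 0 < k) :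
    Halts (cfgCE R k S) true 3 := by
  obtain ⟨k, rfl⟩ : ∃ k', k = k' + 1 := ⟨k - 1, by omega⟩
  refine (Halts.of_reach (N₁ := 1) (Reach.of_eq ?_)
    (halts_ACC { R with w2 := [], u := List.replicate k true, t := [], s := S } hR)).mono (by omega)
  simp [cfgCE, List.replicate_succ]

/-- The end of the code with the budget exactly consumed: evaluation starts at `D0`. [folklore] -/
theorem phaseCE_zero (R : RegFile) (S : List Bool) :
    Reach (cfgCE R 0 S) ⟨64, mk { R with w2 := [], u := [], t := [], s := S }⟩ 1 :=
  Reach.of_eq (by simp [cfgCE])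



/-! ### Phase D: loops (payload move, pours, clears) -/

/-- Moving a variable's payload from the token stack to `q` (the loop `DvarL`): the pairs
`(1, pᵢ)` are consumed and the bits `pᵢ` pushed on `q` (hence reversed). [folklore] -/
theorem varLoop (R : RegFile) : ∀ (bs S Q : List Bool),
    tautProg.step^[4 * bs.length] ⟨80, mk { R with s := pbits bs ++ S, q := Q }⟩ =
      ⟨80, mk { R with s := S, q := bs.reverse ++ Q }⟩ := by
  intro bs
  induction bs with
  | nil => intro S Q; simp
  | cons b bs ih =>
    intro S Q
    rw [show 4 * (b :: bs).length = 4 + 4 * bs.length by simp; ring, steps_add]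
    have h4 : tautProg.step^[4] ⟨80, mk { R with s := pbits (b :: bs) ++ S, q := Q }⟩ =
        ⟨80, mk { R with s := pbits bs ++ S, q := b :: Q }⟩ := by
      cases b <;> simp
    rw [h4, ih]
    simp

/-- Pouring `q` onto `q2` (the loop `QP0`), ending at the lookup start `K0m`. [folklore] -/
theorem pour_q (R : RegFile) : ∀ (a : List Bool),
    tautProg.step^[3 * a.length + 1] ⟨86, mk { R with q := a }⟩ =
      ⟨91, mk { R with q := [], q2 := a.reverse ++ R.q2 }⟩ := by
  intro a
  induction a generalizing R with
  | nil => cases R; simp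
  | cons b a ih =>
    rw [show 3 * (b :: a).length + 1 = 3 + (3 * a.length + 1) by simp; ring, steps_add]
    have := ih { R with q2 := b :: R.q2 }
    cases b <;> simpa using this

/-- Restoring the query: pouring `q` back onto `q2` (the loop `QR`), ending at `K0m`.
[folklore] -/
theorem restore_q (R : RegFile) : ∀ (a : List Bool),
    tautProg.step^[3 * a.length + 1] ⟨146, mk { R with q := a }⟩ =
      ⟨91, mk { R with q := [], q2 := a.reverse ++ R.q2 }⟩ := by
  intro a
  induction a generalizing R with
  | nil => cases R; simp
  | cons b a ih =>
    rw [show 3 * (b :: a).length + 1 = 3 + (3 * a.length + 1) by simp; ring, steps_add]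
    have := ih { R with q2 := b :: R.q2 }
    cases b <;> simpa using this

/-- Restoring the certificate: pouring `y2` back onto `inp` (the loop `RY`), ending at the
clearing loop `CQ`. [folklore] -/
theorem pour_y2 (R : RegFile) : ∀ (a : List Bool),
    tautProg.step^[3 * a.length + 1] ⟨156, mk { R with y2 := a }⟩ =
      ⟨161, mk { R with y2 := [], inp := a.reverse ++ R.inp }⟩ := by
  intro a
  induction a generalizing R with
  | nil => cases R; simp
  | cons b a ih =>
    rw [show 3 * (b :: a).length + 1 = 3 + (3 * a.length + 1) by simp; ring, steps_add]
    have := ih { R with inp := b :: R.inp }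
    cases b <;> simpa using this

/-- Clearing `q` (the loop `CQ`). [folklore] -/
theorem clear_q (R : RegFile) : ∀ (a : List Bool),
    tautProg.step^[a.length + 1] ⟨161, mk { R with q := a }⟩ = ⟨162, mk { R with q := [] }⟩ := by
  intro a
  induction a with
  | nil => cases R; simp
  | cons b a ih =>
    rw [show (b :: a).length + 1 = 1 + (a.length + 1) by simp; ring, steps_add]
    cases b <;> simpa using ih

/-- Clearing `q2` (the loop `CQ2`), ending at the evaluation loop `D0`. [folklore] -/
theorem clear_q2 (R : RegFile) : ∀ (a : List Bool),
    tautProg.step^[a.length + 1] ⟨162, mk { R with q2 := a }⟩ = ⟨64, mk { R with q2 := [] }⟩ := by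
  intro a
  induction a with
  | nil => cases R; simp
  | cons b a ih =>
    rw [show (b :: a).length + 1 = 1 + (a.length + 1) by simp; ring, steps_add]
    cases b <;> simpa using ih

/-! ### Phase D: the table lookup (`lookup`) -/

/-- Program counter of the table reader in state `st`: match mode (`m = true`) runs in the
`K?m` block, mismatch mode in the `K?n` block. [folklore] -/
def pcK : LkSt → ℕ
  | .k0 true _ => 91
  | .k0 false _ => 116
  | .k1 true _ true => 96
  | .k1 true _ false => 101
  | .k1 false _ true => 121
  | .k1 false _ false => 126
  | .val true => 136
  | .val false => 141

/-- Register invariant of the table reader for the query `qry`: `q` holds the compared query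
bits (reversed), `q2` the pending ones; in match mode the pending bits are those of the
specification state. [folklore] -/
def InvK (qry : List Bool) : LkSt → List Bool → List Bool → Prop
  | .k0 m qs, qr, qu => qr.reverse ++ qu = qry ∧ (m = true → qu = qs)
  | .k1 m qs _, qr, qu => qr.reverse ++ qu = qry ∧ (m = true → qu = qs)
  | .val _, qr, qu => qr.reverse ++ qu = qry

/-- The invariant determines the total size of the two query registers. [folklore] -/
theorem InvK.length_eq {qry : List Bool} {st : LkSt} {qr qu : List Bool} (h : InvK qry st qr qu) :
    qr.length + qu.length = qry.length := by
  have e : qr.reverse ++ qu = qry := by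
    rcases st with ⟨m, qs⟩ | ⟨m, qs, b⟩ | m
    · exact h.1
    · exact h.1
    · exact h
  have := congrArg List.length e
  simpa using this

/-- Step budget of the lookup: per unread certificate bit, plus the deferred cost of
restoring the compared query bits. [folklore] -/
def bdK (n k : ℕ) : ℕ := 10 * n + 3 * k + 5

/-- The outcome of a lookup from configuration `c`: the result register state is reached at
the restore loop `RY` with the value `val` pushed on `v`, the query registers of total size
`|qry|`, and the certificate split between `y2` (read part, reversed, of length `≤ n0`) and
`inp` (unread part) with `y2ʳ ++ inp = yr`. [folklore] -/
def KOut (R : RegFile) (qry : List Bool) (val : Bool) (c : SCfg 11) (n0 : ℕ) (yr : List Bool)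
    (N : ℕ) : Prop :=
  ∃ qr' qu' y2' r' : List Bool, qr'.length + qu'.length = qry.length ∧ y2'.reverse ++ r' = yr ∧
    y2'.length ≤ n0 ∧
    Reach c ⟨156, mk { R with inp := r', y2 := y2', q := qr', q2 := qu', v := val :: R.v }⟩ N

/-- Adjusting the parameters of an outcome. [folklore] -/
theorem KOut.cast {R : RegFile} {qry : List Bool} {val : Bool} {c : SCfg 11} {n0 n0' : ℕ}
    {yr yr' : List Bool} {N N' : ℕ} (h : KOut R qry val c n0 yr N) (hn : n0 ≤ n0') (hy : yr = yr')
    (hN : N ≤ N') : KOut R qry val c n0' yr' N' := by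
  obtain ⟨qr', qu', y2', r', h1, h2, h3, h4⟩ := h
  exact ⟨qr', qu', y2', r', h1, h2.trans hy, h3.trans hn, h4.mono hN⟩

/-- Prefixing an outcome by a computation. [folklore] -/
theorem KOut.of_reach {R : RegFile} {qry : List Bool} {val : Bool} {c c' : SCfg 11} {n0 : ℕ}
    {yr : List Bool} {N₁ N₂ : ℕ} (h₁ : Reach c c' N₁) (h₂ : KOut R qry val c' n0 yr N₂) :
    KOut R qry val c n0 yr (N₁ + N₂) := by
  obtain ⟨qr', qu', y2', r', e1, e2, e3, e4⟩ := h₂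
  exact ⟨qr', qu', y2', r', e1, e2, e3, h₁.trans e4⟩

/-- A failed lookup (a `0` where the second bit of a pair `1?` or the like is malformed): the
bit is recorded and `LFAIL` yields the result `false`. [folklore] -/
theorem KOut.fail (R : RegFile) {qry qr qu : List Bool} (hl : qr.length + qu.length = qry.length)
    (y2 r : List Bool) (pc : ℕ) {N : ℕ}
    (h : tautProg.step^[6] ⟨pc, mk { R with inp := false :: r, y2 := y2, q := qr, q2 := qu }⟩ =
      ⟨156, mk { R with inp := r, y2 := false :: y2, q := qr, q2 := qu, v := false :: R.v }⟩)
    (hN : 6 ≤ N) :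
    KOut R qry false ⟨pc, mk { R with inp := false :: r, y2 := y2, q := qr, q2 := qu }⟩
      (y2.length + (false :: r).length) (y2.reverse ++ false :: r) N :=
  ⟨qr, qu, false :: y2, r, hl, by simp, by simp, (Reach.of_eq h).mono hN⟩

/-- **Phase D simulates the table lookup** `lookup qry st r` from any reader state satisfying
the register invariant, within the budget `bdK`. [folklore] -/
theorem phaseK (R : RegFile) (qry : List Bool) : ∀ (r : List Bool) (st : LkSt) (qr qu y2 : List Bool),
    InvK qry st qr qu →
    KOut R qry (lookup qry st r) ⟨pcK st, mk { R with inp := r, y2 := y2, q := qr, q2 := qu }⟩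
      (y2.length + r.length) (y2.reverse ++ r) (bdK r.length qr.length) := by
  intro r
  induction r with
  | nil =>
    intro st qr qu y2 hinv
    have hl := hinv.length_eq
    have e : lookup qry st [] = false := by
      rcases st with ⟨m, qs⟩ | ⟨m, qs, b⟩ | m <;> rfl
    rw [e]
    refine ⟨qr, qu, y2, [], hl, by simp, by simp, ?_⟩
    refine (Reach.of_eq (n := 4) ?_).mono (by
      simp only [bdK, List.length_nil] ; omega)
    rcases st with ⟨_ | _, qs⟩ | ⟨_ | _, qs, _ | _⟩ | ⟨_ | _⟩ <;> simp [pcK]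
  | cons b r ih =>
    intro st qr qu y2 hinv
    have hl := hinv.length_eq
    rcases st with ⟨m, qs⟩ | ⟨m, qs, b₀⟩ | m
    · /- `k0`: read the first bit of a key pair -/
      rw [show lookup qry (.k0 m qs) (b :: r) = lookup qry (.k1 m qs b) r from rfl]
      have h1 : Reach ⟨pcK (.k0 m qs), mk { R with inp := b :: r, y2 := y2, q := qr, q2 := qu }⟩
          ⟨pcK (.k1 m qs b), mk { R with inp := r, y2 := b :: y2, q := qr, q2 := qu }⟩ 3 :=
        Reach.of_eq (by cases m <;> cases b <;> simp [pcK])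
      exact (KOut.of_reach h1 (ih (.k1 m qs b) qr qu (b :: y2) hinv)).cast (by simp; omega)
        (by simp) (by
      simp only [bdK, List.length_cons] ; omega)
    · /- `k1`: read the second bit of a key pair -/
      obtain ⟨hq, hm⟩ : qr.reverse ++ qu = qry ∧ (m = true → qu = qs) := hinv
      cases m with
      | true =>
        obtain rfl : qu = qs := hm rfl
        cases b₀ with
        | true =>
          cases b with
          | true =>
            -- key bit `1`: compare with the next query bit
            cases qu with
            | nil =>
              rw [show lookup qry (.k1 true [] true) (true :: r) = lookup qry (.k0 false []) r by
                simp [lookup]]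
              have h1 : Reach ⟨pcK (.k1 true [] true), mk { R with inp := true :: r, y2 := y2, q := qr, q2 := [] }⟩
                  ⟨pcK (.k0 false []), mk { R with inp := r, y2 := true :: y2, q := qr, q2 := [] }⟩ 4 :=
                Reach.of_eq (by simp [pcK])
              exact (KOut.of_reach h1 (ih (.k0 false []) qr [] (true :: y2) ⟨hq, by simp⟩)).cast
                (by simp; omega) (by simp) (by
      simp only [bdK, List.length_cons] ; omega)
            | cons q₁ qs' =>
              rw [show lookup qry (.k1 true (q₁ :: qs') true) (true :: r) =
                  lookup qry (.k0 (q₁ == true) qs') r by simp [lookup]]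
              have h1 : Reach
                  ⟨pcK (.k1 true (q₁ :: qs') true), mk { R with inp := true :: r, y2 := y2, q := qr, q2 := q₁ :: qs' }⟩
                  ⟨pcK (.k0 (q₁ == true) qs'), mk { R with inp := r, y2 := true :: y2, q := q₁ :: qr, q2 := qs' }⟩ 6 :=
                Reach.of_eq (by cases q₁ <;> simp [pcK])
              exact (KOut.of_reach h1 (ih (.k0 (q₁ == true) qs') (q₁ :: qr) qs' (true :: y2)
                ⟨by simpa using hq, fun _ => rfl⟩)).cast (by simp; omega) (by simp) (by
      simp only [bdK, List.length_cons] ; omega)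
          | false =>
            -- a `10` pair: malformed table, result `false`
            rw [show lookup qry (.k1 true qu true) (false :: r) = false by simp [lookup]]
            exact KOut.fail R hl y2 r (pcK _) (by simp [pcK]) (by
      simp only [bdK, List.length_cons] ; omega)
        | false =>
          cases b with
          | true =>
            -- end of key (`01`): full match iff no query bit is pending
            cases qu with
            | nil =>
              rw [show lookup qry (.k1 true [] false) (true :: r) = lookup qry (.val true) r by
                simp [lookup]]
              have h1 : Reach ⟨pcK (.k1 true [] false), mk { R with inp := true :: r, y2 := y2, q := qr, q2 := [] }⟩
                  ⟨pcK (.val true), mk { R with inp := r, y2 := true :: y2, q := qr, q2 := [] }⟩ 4 :=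
                Reach.of_eq (by simp [pcK])
              exact (KOut.of_reach h1 (ih (.val true) qr [] (true :: y2) hq)).cast
                (by simp; omega) (by simp) (by
      simp only [bdK, List.length_cons] ; omega)
            | cons q₁ qs' =>
              rw [show lookup qry (.k1 true (q₁ :: qs') false) (true :: r) = lookup qry (.val false) r by
                simp [lookup]]
              have h1 : Reach
                  ⟨pcK (.k1 true (q₁ :: qs') false), mk { R with inp := true :: r, y2 := y2, q := qr, q2 := q₁ :: qs' }⟩
                  ⟨pcK (.val false), mk { R with inp := r, y2 := true :: y2, q := qr, q2 := q₁ :: qs' }⟩ 6 :=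
                Reach.of_eq (by cases q₁ <;> simp [pcK])
              exact (KOut.of_reach h1 (ih (.val false) qr (q₁ :: qs') (true :: y2) hq)).cast
                (by simp; omega) (by simp) (by
      simp only [bdK, List.length_cons] ; omega)
          | false =>
            -- key bit `0`: compare with the next query bit
            cases qu with
            | nil =>
              rw [show lookup qry (.k1 true [] false) (false :: r) = lookup qry (.k0 false []) r by
                simp [lookup]]
              have h1 : Reach ⟨pcK (.k1 true [] false), mk { R with inp := false :: r, y2 := y2, q := qr, q2 := [] }⟩
                  ⟨pcK (.k0 false []), mk { R with inp := r, y2 := false :: y2, q := qr, q2 := [] }⟩ 4 :=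
                Reach.of_eq (by simp [pcK])
              exact (KOut.of_reach h1 (ih (.k0 false []) qr [] (false :: y2) ⟨hq, by simp⟩)).cast
                (by simp; omega) (by simp) (by
      simp only [bdK, List.length_cons] ; omega)
            | cons q₁ qs' =>
              rw [show lookup qry (.k1 true (q₁ :: qs') false) (false :: r) =
                  lookup qry (.k0 (q₁ == false) qs') r by simp [lookup]]
              have h1 : Reach
                  ⟨pcK (.k1 true (q₁ :: qs') false), mk { R with inp := false :: r, y2 := y2, q := qr, q2 := q₁ :: qs' }⟩
                  ⟨pcK (.k0 (q₁ == false) qs'), mk { R with inp := r, y2 := false :: y2, q := q₁ :: qr, q2 := qs' }⟩ 6 :=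
                Reach.of_eq (by cases q₁ <;> simp [pcK])
              exact (KOut.of_reach h1 (ih (.k0 (q₁ == false) qs') (q₁ :: qr) qs' (false :: y2)
                ⟨by simpa using hq, fun _ => rfl⟩)).cast (by simp; omega) (by simp) (by
      simp only [bdK, List.length_cons] ; omega)
      | false =>
        cases b₀ with
        | true =>
          cases b with
          | true =>
            -- mismatch mode, key bit `1`: skip
            have e : ∃ qs', lookup qry (.k1 false qs true) (true :: r) = lookup qry (.k0 false qs') r := by
              cases qs with
              | nil => exact ⟨[], by simp [lookup]⟩
              | cons q₁ qs' => exact ⟨qs', by simp [lookup]⟩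
            obtain ⟨qs', e⟩ := e
            rw [e]
            have h1 : Reach ⟨pcK (.k1 false qs true), mk { R with inp := true :: r, y2 := y2, q := qr, q2 := qu }⟩
                ⟨pcK (.k0 false qs'), mk { R with inp := r, y2 := true :: y2, q := qr, q2 := qu }⟩ 3 :=
              Reach.of_eq (by simp [pcK])
            exact (KOut.of_reach h1 (ih (.k0 false qs') qr qu (true :: y2) ⟨hq, by simp⟩)).cast
              (by simp; omega) (by simp) (by
      simp only [bdK, List.length_cons] ; omega)
          | false =>
            rw [show lookup qry (.k1 false qs true) (false :: r) = false by simp [lookup]]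
            exact KOut.fail R hl y2 r (pcK _) (by simp [pcK]) (by
      simp only [bdK, List.length_cons] ; omega)
        | false =>
          cases b with
          | true =>
            -- mismatch mode, end of key: skip the value
            rw [show lookup qry (.k1 false qs false) (true :: r) = lookup qry (.val false) r by
              simp [lookup]]
            have h1 : Reach ⟨pcK (.k1 false qs false), mk { R with inp := true :: r, y2 := y2, q := qr, q2 := qu }⟩
                ⟨pcK (.val false), mk { R with inp := r, y2 := true :: y2, q := qr, q2 := qu }⟩ 3 :=
              Reach.of_eq (by simp [pcK])
            exact (KOut.of_reach h1 (ih (.val false) qr qu (true :: y2) hq)).cast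
              (by simp; omega) (by simp) (by
      simp only [bdK, List.length_cons] ; omega)
          | false =>
            -- mismatch mode, key bit `0`: skip
            have e : ∃ qs', lookup qry (.k1 false qs false) (false :: r) = lookup qry (.k0 false qs') r := by
              cases qs with
              | nil => exact ⟨[], by simp [lookup]⟩
              | cons q₁ qs' => exact ⟨qs', by simp [lookup]⟩
            obtain ⟨qs', e⟩ := e
            rw [e]
            have h1 : Reach ⟨pcK (.k1 false qs false), mk { R with inp := false :: r, y2 := y2, q := qr, q2 := qu }⟩
                ⟨pcK (.k0 false qs'), mk { R with inp := r, y2 := false :: y2, q := qr, q2 := qu }⟩ 3 :=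
              Reach.of_eq (by simp [pcK])
            exact (KOut.of_reach h1 (ih (.k0 false qs') qr qu (false :: y2) ⟨hq, by simp⟩)).cast
              (by simp; omega) (by simp) (by
      simp only [bdK, List.length_cons] ; omega)
    · /- `val`: the value bit of an entry -/
      have hq : qr.reverse ++ qu = qry := hinv
      cases m with
      | true =>
        -- full match: the result is this bit
        rw [show lookup qry (.val true) (b :: r) = b by simp [lookup]]
        refine ⟨qr, qu, b :: y2, r, hl, by simp, by simp, ?_⟩
        refine (Reach.of_eq (n := 5) ?_).mono (by
      simp only [bdK, List.length_cons] ; omega)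
        cases b <;> simp [pcK]
      | false =>
        -- no match: restore the query and read the next entry
        rw [show lookup qry (.val false) (b :: r) = lookup qry (.k0 true qry) r by simp [lookup]]
        have h1 : Reach ⟨pcK (.val false), mk { R with inp := b :: r, y2 := y2, q := qr, q2 := qu }⟩
            ⟨146, mk { R with inp := r, y2 := b :: y2, q := qr, q2 := qu }⟩ 3 :=
          Reach.of_eq (by cases b <;> simp [pcK])
        have h2 : Reach ⟨146, mk { R with inp := r, y2 := b :: y2, q := qr, q2 := qu }⟩
            ⟨pcK (.k0 true qry), mk { R with inp := r, y2 := b :: y2, q := [], q2 := qry }⟩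
            (3 * qr.length + 1) :=
          Reach.of_eq (by
            simpa [pcK, hq] using restore_q { R with inp := r, y2 := b :: y2, q2 := qu } qr)
        exact (KOut.of_reach (h1.trans h2) (ih (.k0 true qry) [] qry (b :: y2) ⟨by simp, fun _ => rfl⟩)).cast
          (by simp; omega) (by simp) (by
      simp only [bdK, List.length_cons, List.length_nil] ; omega)



/-! ### Phase D, specification level: reverse-Polish *evaluation* -/

/-- One step of reverse-Polish evaluation under an assignment `σ` (the value-level companion
of `rpnStep`): leaves push their value, connectives pop their arguments and push the result;
`none` on underflow. [folklore] -/
def vrpnStep (σ : List Bool → Bool) : List Bool → FTok → Option (List Bool)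
  | stk, .var bs => some (σ bs :: stk)
  | stk, .const b => some (b :: stk)
  | v :: stk, .neg => some ((!v) :: stk)
  | v₁ :: v₂ :: stk, .conj => some ((v₁ && v₂) :: stk)
  | v₁ :: v₂ :: stk, .disj => some ((v₁ || v₂) :: stk)
  | _, _ => none

/-- Reverse-Polish evaluation of a token list (fed the reversed token string). [folklore] -/
def vrpn (σ : List Bool → Bool) : List FTok → List Bool → Option (List Bool)
  | [], stk => some stk
  | t :: ts, stk => (vrpnStep σ stk t).bind (vrpn σ ts)

/-- `vrpnStep` is `rpnStep` followed by evaluation. [folklore] -/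
theorem vrpnStep_map (σ : List Bool → Bool) (stk : List (PropForm (List Bool))) (t : FTok) :
    vrpnStep σ (stk.map (PropForm.eval σ)) t = (rpnStep stk t).map (List.map (PropForm.eval σ)) := by
  cases t with
  | var bs => rfl
  | const b => rfl
  | neg => rcases stk with _ | ⟨t₁, stk⟩ <;> rfl
  | conj => rcases stk with _ | ⟨t₁, _ | ⟨t₂, stk⟩⟩ <;> rfl
  | disj => rcases stk with _ | ⟨t₁, _ | ⟨t₂, stk⟩⟩ <;> rfl

/-- **Evaluation is parsing followed by `eval`.** [folklore] -/
theorem vrpn_map (σ : List Bool → Bool) : ∀ (ts : List FTok) (stk : List (PropForm (List Bool))),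
    vrpn σ ts (stk.map (PropForm.eval σ)) = (rpn ts stk).map (List.map (PropForm.eval σ))
  | [], stk => rfl
  | t :: ts, stk => by
    rw [vrpn, rpn, vrpnStep_map]
    cases rpnStep stk t with
    | none => rfl
    | some stk' => exact vrpn_map σ ts stk'

/-- In particular from the empty stack. [folklore] -/
theorem vrpn_nil_eq (σ : List Bool → Bool) (ts : List FTok) :
    vrpn σ ts [] = (rpn ts []).map (List.map (PropForm.eval σ)) := by
  simpa using vrpn_map σ ts []

/-- The verdict of phase E on the final value stack: accept unless exactly one value, `true`,
remains. [folklore] -/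
def verdictE : List Bool → Bool
  | [true] => false
  | _ => true

/-- One remaining value: the verdict is its negation. [folklore] -/
theorem verdictE_singleton (b : Bool) : verdictE [b] = !b := by cases b <;> rfl

/-- Two or more remaining values: accept. [folklore] -/
theorem verdictE_cons_cons (a b : Bool) (l : List Bool) : verdictE (a :: b :: l) = true := by
  cases a <;> rfl

/-! ### The table lookup: irrelevance of the pending query in mismatch mode -/

/-- In mismatch mode the unread query bits are irrelevant. [folklore] -/
theorem lookup_k0_false (q : List Bool) : ∀ (r qs qs' : List Bool),
    lookup q (.k0 false qs) r = lookup q (.k0 false qs') r := by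
  intro r
  induction r using List.twoStepInduction with
  | nil => intro qs qs'; rfl
  | singleton b => intro qs qs'; simp [lookup]
  | cons_cons b b' r ih _ =>
    intro qs qs'
    simp only [lookup, Bool.false_and]
    split
    · cases qs <;> cases qs' <;> exact ih _ _
    · rfl


/-! ### Phase D: one variable token, and the evaluation loop -/

/-- The evaluation-loop configuration on token stack `S`, value stack `V` and certificate `y`
(query and saved-certificate registers empty). [folklore] -/
def cfgD (R : RegFile) (y S V : List Bool) : SCfg 11 :=
  ⟨64, mk { R with s := S, v := V, inp := y, y2 := [], q := [], q2 := [] }⟩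

/-- **A variable token**: its payload is moved to the query registers, looked up in the
certificate (`certAssignment`), the value pushed, and the certificate and query registers
restored, in `8·|payload| + 13·|y| + 12` steps. [folklore] -/
theorem tokVar (R : RegFile) (y bs S V : List Bool) :
    Reach (cfgD R y (tokCode (.var bs) ++ S) V) (cfgD R y S (certAssignment y bs :: V))
      (8 * bs.length + 13 * y.length + 12) := by
  -- pop the leaf and variable tags
  have h1 : Reach (cfgD R y (tokCode (.var bs) ++ S) V)
      ⟨80, mk { R with s := pbits bs ++ (false :: S), v := V, inp := y, y2 := [], q := [], q2 := [] }⟩ 2 :=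
    Reach.of_eq (by simp [cfgD, tokCode_var])
  -- move the payload
  have h2 : Reach ⟨80, mk { R with s := pbits bs ++ (false :: S), v := V, inp := y, y2 := [], q := [], q2 := [] }⟩
      ⟨80, mk { R with s := false :: S, v := V, inp := y, y2 := [], q := bs.reverse, q2 := [] }⟩
      (4 * bs.length) :=
    Reach.of_eq (by
      simpa using varLoop { R with v := V, inp := y, y2 := [], q2 := [] } bs (false :: S) [])
  -- end of the payload; pour the query into reading order
  have h3 : Reach ⟨80, mk { R with s := false :: S, v := V, inp := y, y2 := [], q := bs.reverse, q2 := [] }⟩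
      ⟨86, mk { R with s := S, v := V, inp := y, y2 := [], q := bs.reverse, q2 := [] }⟩ 1 :=
    Reach.of_eq (by simp)
  have h4 : Reach ⟨86, mk { R with s := S, v := V, inp := y, y2 := [], q := bs.reverse, q2 := [] }⟩
      ⟨pcK (.k0 true bs), mk { R with s := S, v := V, inp := y, y2 := [], q := [], q2 := bs }⟩
      (3 * bs.reverse.length + 1) :=
    Reach.of_eq (by
      simpa [pcK] using pour_q { R with s := S, v := V, inp := y, y2 := [], q2 := [] } bs.reverse)
  -- the lookup
  obtain ⟨qr', qu', y2', r', hl, hyr, hy2, h5⟩ :=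
    phaseK { R with s := S, v := V } bs y (.k0 true bs) [] bs [] ⟨by simp, fun _ => rfl⟩
  simp only [List.length_nil, zero_add, List.reverse_nil, List.nil_append] at hyr hy2 h5
  -- restore the certificate, clear the query registers
  have h6 : Reach
      ⟨156, mk { R with s := S, v := lookup bs (.k0 true bs) y :: V, inp := r', y2 := y2', q := qr', q2 := qu' }⟩
      ⟨161, mk { R with s := S, v := lookup bs (.k0 true bs) y :: V, inp := y, y2 := [], q := qr', q2 := qu' }⟩
      (3 * y2'.length + 1) :=
    Reach.of_eq (by
      simpa [hyr] using
        pour_y2 { R with s := S, v := lookup bs (.k0 true bs) y :: V, inp := r', q := qr', q2 := qu' } y2')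
  have h7 : Reach
      ⟨161, mk { R with s := S, v := lookup bs (.k0 true bs) y :: V, inp := y, y2 := [], q := qr', q2 := qu' }⟩
      ⟨162, mk { R with s := S, v := lookup bs (.k0 true bs) y :: V, inp := y, y2 := [], q := [], q2 := qu' }⟩
      (qr'.length + 1) :=
    Reach.of_eq (by
      simpa using clear_q { R with s := S, v := lookup bs (.k0 true bs) y :: V, inp := y, y2 := [], q2 := qu' } qr')
  have h8 : Reach
      ⟨162, mk { R with s := S, v := lookup bs (.k0 true bs) y :: V, inp := y, y2 := [], q := [], q2 := qu' }⟩
      (cfgD R y S (certAssignment y bs :: V)) (qu'.length + 1) :=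
    Reach.of_eq (by
      simpa [cfgD, certAssignment] using
        clear_q2 { R with s := S, v := lookup bs (.k0 true bs) y :: V, inp := y, y2 := [], q := [] } qu')
  exact ((((h1.trans h2).trans h3).trans h4).trans (((h5.trans h6).trans h7).trans h8)).mono (by
      simp only [bdK, List.length_reverse] ; omega)

/-- Cost of a token in phase D. [folklore] -/
def costD (y : List Bool) : FTok → ℕ
  | .var bs => 8 * bs.length + 13 * y.length + 12
  | _ => 8

/-- Step budget of phase D on a (reversed) token list. [folklore] -/
def bdD (y : List Bool) : List FTok → ℕ
  | [] => 1
  | t :: us => costD y t + bdD y us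

/-- The outcome of phase D according to the result of the evaluation `vrpn`: an underflow is
accepted (the instance is not a formula code); otherwise phase E is reached with the final
value stack. [folklore] -/
def DOut (R : RegFile) (y : List Bool) (res : Option (List Bool)) (c : SCfg 11) (N : ℕ) : Prop :=
  match res with
  | none => Halts c true N
  | some V => Reach c ⟨163, mk { R with s := [], v := V, inp := y, y2 := [], q := [], q2 := [] }⟩ N

/-- Weakening the step bound of an outcome. [folklore] -/
theorem DOut.mono {R : RegFile} {y : List Bool} {res : Option (List Bool)} {c : SCfg 11} {N N' : ℕ}
    (h : DOut R y res c N) (hN : N ≤ N') : DOut R y res c N' := by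
  cases res with
  | none => exact Halts.mono h hN
  | some V => exact Reach.mono h hN

/-- Prefixing an outcome by a computation. [folklore] -/
theorem DOut.of_reach {R : RegFile} {y : List Bool} {res : Option (List Bool)} {c c' : SCfg 11}
    {N₁ N₂ : ℕ} (h₁ : Reach c c' N₁) (h₂ : DOut R y res c' N₂) : DOut R y res c (N₁ + N₂) := by
  cases res with
  | none => exact Halts.of_reach h₁ h₂
  | some V => exact h₁.trans h₂

/-- **Phase D simulates reverse-Polish evaluation** (`vrpn` under the certificate's assignment)
of the token codes on the token stack. [folklore] -/
theorem phaseD (R : RegFile) (hR : R.out = []) (y : List Bool) : ∀ (us : List FTok) (V : List Bool),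
    DOut R y (vrpn (certAssignment y) us V) (cfgD R y (us.flatMap tokCode) V) (bdD y us) := by
  intro us
  induction us with
  | nil =>
    intro V
    show Reach _ _ 1
    exact Reach.of_eq (by simp [cfgD])
  | cons t us ih =>
    intro V
    rw [List.flatMap_cons, bdD]
    have hacc : ∀ S' : List Bool, Halts ⟨165, mk { R with s := S', v := [], inp := y, y2 := [], q := [], q2 := [] }⟩
        true 2 := fun S' => halts_ACC { R with s := S', v := [], inp := y, y2 := [], q := [], q2 := [] } hR
    cases t with
    | const b =>
      rw [show vrpn (certAssignment y) (.const b :: us) V = vrpn (certAssignment y) us (b :: V) from rfl]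
      have h1 : Reach (cfgD R y (tokCode (.const b) ++ us.flatMap tokCode) V)
          (cfgD R y (us.flatMap tokCode) (b :: V)) 5 :=
        Reach.of_eq (by cases b <;> simp [cfgD, tokCode])
      exact (DOut.of_reach h1 (ih (b :: V))).mono (by simp only [costD]; omega)
    | var bs =>
      rw [show vrpn (certAssignment y) (.var bs :: us) V =
        vrpn (certAssignment y) us (certAssignment y bs :: V) from rfl]
      exact (DOut.of_reach (tokVar R y bs _ V) (ih _)).mono (by simp only [costD]; omega)
    | neg =>
      cases V with
      | nil =>
        rw [show vrpn (certAssignment y) (.neg :: us) [] = none from rfl]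
        show Halts _ true _
        refine (Halts.of_reach (N₁ := 3) (Reach.of_eq ?_) (hacc (us.flatMap tokCode))).mono
          (by simp only [costD]; omega)
        simp [cfgD, tokCode]
      | cons v V =>
        rw [show vrpn (certAssignment y) (.neg :: us) (v :: V) = vrpn (certAssignment y) us ((!v) :: V) from rfl]
        have h1 : Reach (cfgD R y (tokCode .neg ++ us.flatMap tokCode) (v :: V))
            (cfgD R y (us.flatMap tokCode) ((!v) :: V)) 5 :=
          Reach.of_eq (by cases v <;> simp [cfgD, tokCode])
        exact (DOut.of_reach h1 (ih _)).mono (by simp only [costD]; omega)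
    | conj =>
      rcases V with _ | ⟨v₁, _ | ⟨v₂, V⟩⟩
      · rw [show vrpn (certAssignment y) (.conj :: us) [] = none from rfl]
        show Halts _ true _
        refine (Halts.of_reach (N₁ := 4) (Reach.of_eq ?_) (hacc (us.flatMap tokCode))).mono
          (by simp only [costD]; omega)
        simp [cfgD, tokCode]
      · rw [show vrpn (certAssignment y) (.conj :: us) [v₁] = none from rfl]
        show Halts _ true _
        refine (Halts.of_reach (N₁ := 5) (Reach.of_eq ?_) (hacc (us.flatMap tokCode))).mono
          (by simp only [costD]; omega)
        cases v₁ <;> simp [cfgD, tokCode]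
      · rw [show vrpn (certAssignment y) (.conj :: us) (v₁ :: v₂ :: V) =
          vrpn (certAssignment y) us ((v₁ && v₂) :: V) from rfl]
        have h1 : Reach (cfgD R y (tokCode .conj ++ us.flatMap tokCode) (v₁ :: v₂ :: V))
            (cfgD R y (us.flatMap tokCode) ((v₁ && v₂) :: V)) 7 :=
          Reach.of_eq (by cases v₁ <;> cases v₂ <;> simp [cfgD, tokCode])
        exact (DOut.of_reach h1 (ih _)).mono (by simp only [costD]; omega)
    | disj =>
      rcases V with _ | ⟨v₁, _ | ⟨v₂, V⟩⟩
      · rw [show vrpn (certAssignment y) (.disj :: us) [] = none from rfl]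
        show Halts _ true _
        refine (Halts.of_reach (N₁ := 4) (Reach.of_eq ?_) (hacc (us.flatMap tokCode))).mono
          (by simp only [costD]; omega)
        simp [cfgD, tokCode]
      · rw [show vrpn (certAssignment y) (.disj :: us) [v₁] = none from rfl]
        show Halts _ true _
        refine (Halts.of_reach (N₁ := 5) (Reach.of_eq ?_) (hacc (us.flatMap tokCode))).mono
          (by simp only [costD]; omega)
        cases v₁ <;> simp [cfgD, tokCode]
      · rw [show vrpn (certAssignment y) (.disj :: us) (v₁ :: v₂ :: V) =
          vrpn (certAssignment y) us ((v₁ || v₂) :: V) from rfl]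
        have h1 : Reach (cfgD R y (tokCode .disj ++ us.flatMap tokCode) (v₁ :: v₂ :: V))
            (cfgD R y (us.flatMap tokCode) ((v₁ || v₂) :: V)) 7 :=
          Reach.of_eq (by cases v₁ <;> cases v₂ <;> simp [cfgD, tokCode])
        exact (DOut.of_reach h1 (ih _)).mono (by simp only [costD]; omega)

/-! ### Phase E: the verdict -/

/-- Phase E halts with output `verdictE V`: reject iff exactly one value, `true`, remains.
[folklore] -/
theorem phaseE (R : RegFile) (hR : R.out = []) (V : List Bool) :
    Halts ⟨163, mk { R with v := V }⟩ (verdictE V) 4 := by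
  rcases V with _ | ⟨_ | _, _ | ⟨v, V⟩⟩
  · show Halts _ true 4
    refine (Halts.of_reach (N₁ := 1) (Reach.of_eq ?_) (halts_ACC { R with v := [] } hR)).mono (by omega)
    simp
  · show Halts _ true 4
    refine (Halts.of_reach (N₁ := 1) (Reach.of_eq ?_) (halts_ACC { R with v := [] } hR)).mono (by omega)
    simp
  · show Halts _ true 4
    refine (Halts.of_reach (N₁ := 1) (Reach.of_eq ?_) (halts_ACC { R with v := v :: V } hR)).mono (by omega)
    simp
  · show Halts _ false 4
    refine (Halts.of_reach (N₁ := 2) (Reach.of_eq ?_) (halts_REJ { R with v := [] } hR)).mono (by omega)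
    simp
  · show Halts _ true 4
    refine (Halts.of_reach (N₁ := 2) (Reach.of_eq ?_) (halts_ACC { R with v := V } hR)).mono (by omega)
    cases v <;> simp

/-! ### Size bounds -/

/-- `|pbits bs| = 2|bs|`. [folklore] -/
@[simp] theorem length_pbits (bs : List Bool) : (pbits bs).length = 2 * bs.length := by
  induction bs with
  | nil => rfl
  | cons b bs ih => simp only [pbits_cons, List.length_cons, ih]; omega

/-- `|tokCode (var bs)| = 2|bs| + 3`. [folklore] -/
theorem length_tokCode_var (bs : List Bool) : (tokCode (.var bs)).length = 2 * bs.length + 3 := by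
  rw [tokCode_var]; simp only [List.length_cons, List.length_append, length_pbits, List.length_nil]

/-- The cost of a token is at most `(13|y| + 12)` per bit of its code. [folklore] -/
theorem costD_le (y : List Bool) (t : FTok) : costD y t ≤ (13 * y.length + 12) * (tokCode t).length := by
  cases t with
  | var bs =>
    rw [costD, length_tokCode_var]
    nlinarith [Nat.zero_le (y.length * bs.length), Nat.zero_le y.length, Nat.zero_le bs.length]
  | const b => simp [costD, tokCode]; omega
  | neg => simp [costD, tokCode]; omega
  | conj => simp [costD, tokCode]; omega
  | disj => simp [costD, tokCode]; omega

/-- The budget of phase D is at most `(13|y| + 12)·|S| + 1` for a token stack `S`. [folklore] -/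
theorem bdD_le (y : List Bool) : ∀ us : List FTok,
    bdD y us ≤ (13 * y.length + 12) * (us.flatMap tokCode).length + 1
  | [] => by simp [bdD]
  | t :: us => by
    rw [bdD, List.flatMap_cons, List.length_append, Nat.mul_add]
    have := costD_le y t
    have := bdD_le y us
    omega

/-- A token's stack code is no longer than its bit code. [folklore] -/
theorem length_tokCode_le_bits (t : FTok) : (tokCode t).length ≤ t.bits.length := by
  cases t with
  | var bs => rw [length_tokCode_var]; simp [FTok.bits]
  | const b => simp [tokCode, FTok.bits]
  | neg => simp [tokCode, FTok.bits]
  | conj => simp [tokCode, FTok.bits]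
  | disj => simp [tokCode, FTok.bits]

/-- The token stack is no longer than the tokenized code. [folklore] -/
theorem length_rcode_le (ts : List FTok) : (rcode ts).length ≤ (untok ts).length := by
  induction ts with
  | nil => simp
  | cons t ts ih =>
    simp only [rcode_cons, untok_cons, List.length_append]
    have := length_tokCode_le_bits t
    omega

/-- Soundness of phase A's reading: a successful split comes from a genuine pair. [folklore] -/
theorem unpairA_sound : ∀ (acc z wr y : List Bool), unpairA acc z = some (wr, y) →
    ∃ w : List Bool, wr = w.reverse ++ acc ∧ z = boolPair w y
  | acc, true :: true :: r, wr, y, h => by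
    rw [unpairA] at h
    obtain ⟨w, hw, hz⟩ := unpairA_sound (true :: acc) r wr y h
    exact ⟨true :: w, by simp [hw], by simp [hz, boolPair]⟩
  | acc, false :: false :: r, wr, y, h => by
    rw [unpairA] at h
    obtain ⟨w, hw, hz⟩ := unpairA_sound (false :: acc) r wr y h
    exact ⟨false :: w, by simp [hw], by simp [hz, boolPair]⟩
  | acc, false :: true :: r, wr, y, h => by
    simp [unpairA] at h
    obtain ⟨rfl, rfl⟩ := h
    exact ⟨[], by simp, by simp [boolPair]⟩
  | acc, [], wr, y, h => by simp [unpairA] at h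
  | acc, [true], wr, y, h => by simp [unpairA] at h
  | acc, [false], wr, y, h => by simp [unpairA] at h
  | acc, true :: false :: r, wr, y, h => by simp [unpairA] at h

/-! ### The whole run -/

/-- The all-empty register file. [folklore] -/
def R0 : RegFile := ⟨[], [], [], [], [], [], [], [], [], [], []⟩

/-- **Phases B–E**: started at the header reader with the instance `w` in `w2` and the
certificate `y` in `inp`, the program halts with output `chkTaut w y` within
`(13|y| + 12)|w| + 13|w| + 15` steps. [folklore] -/
theorem halts_BCDE (w y : List Bool) :
    Halts ⟨12, mk { R0 with w2 := w, inp := y }⟩ (chkTaut w y)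
      ((13 * y.length + 12) * w.length + 13 * w.length + 15) := by
  unfold chkTaut
  cases hB : readHdr 0 none w with
  | none =>
    exact (phaseB_none { R0 with inp := y } rfl 0 none w hB).mono (by omega)
  | some p =>
    obtain ⟨s, c⟩ := p
    have hw : w = boolPair (List.replicate s true) c := readHdr_sound₀ hB
    have hc : c.length ≤ w.length := by rw [hw, length_boolPair]; omega
    have h1 := phaseB_some { R0 with inp := y } 0 none w s c hB
    have h2 := phaseC { R0 with inp := y } rfl .start [] c s []
    change COut _ (tokenize c) _ s [] _ at h2
    dsimp only
    cases hC : tokenize c with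
    | none =>
      rw [hC] at h2
      exact (Halts.of_reach h1 h2).mono (by simp only [bdC, accC, List.length_nil]; nlinarith)
    | some ts =>
      rw [hC] at h2
      obtain ⟨h2a, h2b⟩ := h2
      have hS : (rcode ts).length ≤ w.length :=
        (length_rcode_le ts).trans ((tokenize_sound hC).1 ▸ hc)
      have hSw := Nat.mul_le_mul_left (13 * y.length + 12) hS
      dsimp only
      by_cases hlen : ts.length = s
      · rw [if_neg (not_not.2 hlen)]
        have h3 := h2a hlen.le
        rw [hlen, Nat.sub_self, List.append_nil] at h3
        have h4 := phaseCE_zero { R0 with inp := y } (rcode ts)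
        have h5 := phaseD { R0 with inp := y } rfl y ts.reverse []
        rw [vrpn_nil_eq] at h5
        have hbd := bdD_le y ts.reverse
        change bdD y ts.reverse ≤ (13 * y.length + 12) * (rcode ts).length + 1 at hbd
        have hE := fun V : List Bool =>
          phaseE { R0 with s := [], v := V, inp := y, y2 := [], q := [], q2 := [] } rfl V
        unfold parseToks
        rcases hr : rpn ts.reverse [] with _ | ⟨_ | ⟨φ, _ | ⟨ψ, stk⟩⟩⟩
        · -- the token string does not parse: underflow in phase D, accepted
          rw [hr] at h5
          exact (Halts.of_reach ((h1.trans h3).trans h4) h5).mono (by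
            simp only [bdC, accC, List.length_nil]; omega)
        · -- it parses to no formula: accepted in phase E
          rw [hr] at h5
          exact (Halts.of_reach (((h1.trans h3).trans h4).trans h5) (hE [])).mono (by
            simp only [bdC, accC, List.length_nil]; omega)
        · -- it parses to exactly one formula `φ`: the verdict is `¬ φ(σ_y)`
          rw [hr] at h5
          have h6 := hE [φ.eval (certAssignment y)]
          rw [verdictE_singleton] at h6
          exact (Halts.of_reach (((h1.trans h3).trans h4).trans h5) h6).mono (by
            simp only [bdC, accC, List.length_nil]; omega)
        · -- it parses to two or more formulas: accepted in phase E
          rw [hr] at h5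
          have h6 := hE (φ.eval (certAssignment y) :: ψ.eval (certAssignment y) ::
            stk.map (PropForm.eval (certAssignment y)))
          rw [verdictE_cons_cons] at h6
          exact (Halts.of_reach (((h1.trans h3).trans h4).trans h5) h6).mono (by
            simp only [bdC, accC, List.length_nil]; omega)
      · rw [if_pos hlen]
        rcases Nat.lt_or_gt_of_ne hlen with hlt | hgt
        · have h3 := h2a hlt.le
          have h4 := phaseCE_pos { R0 with inp := y } rfl (s - ts.length) (rcode ts ++ []) (by omega)
          exact (Halts.of_reach (h1.trans h3) h4).mono (by simp only [bdC, accC, List.length_nil]; nlinarith)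
        · exact (Halts.of_reach h1 (h2b hgt)).mono (by simp only [bdC, accC, List.length_nil]; nlinarith)

/-- The time bound of the whole program. [folklore] -/
noncomputable def tBound : Polynomial ℕ := 13 * Polynomial.X ^ 2 + 32 * Polynomial.X + 16

/-- Its values. [folklore] -/
theorem tBound_eval (n : ℕ) : tBound.eval n = 13 * n ^ 2 + 32 * n + 16 := by
  simp [tBound]

/-- The arithmetic of the final bound: with `a = |w|`, `b = |y|`, `|⟨w, y⟩| = 2a + 2 + b`. [folklore] -/
theorem bound_arith (a b : ℕ) :
    4 * (2 * a + 2 + b) + (3 * a + 1) + ((13 * b + 12) * a + 13 * a + 15) ≤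
      13 * (2 * a + 2 + b) ^ 2 + 32 * (2 * a + 2 + b) + 16 := by
  nlinarith [Nat.zero_le (a * b), Nat.zero_le (a * a), Nat.zero_le (b * b)]

/-- **The whole run on a pair**: on `⟨w, y⟩` the program halts with output `chkTaut w y` within
`tBound |⟨w, y⟩|` steps. [folklore] -/
theorem halts_boolPair (w y : List Bool) :
    Halts ⟨0, mk { R0 with inp := boolPair w y }⟩ (chkTaut w y) (tBound.eval (boolPair w y).length) := by
  have hA := phaseA_some R0 [] (boolPair w y) (w.reverse ++ []) y (unpairA_boolPair [] w y)
  simp only [List.append_nil] at hA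
  have hP : Reach ⟨7, mk { R0 with w := w.reverse, inp := y }⟩ ⟨12, mk { R0 with w2 := w, inp := y }⟩
      (3 * w.reverse.length + 1) :=
    Reach.of_eq (by simpa [R0] using pour_w { R0 with inp := y } w.reverse)
  simp only [List.length_reverse] at hP
  refine (Halts.of_reach (hA.trans hP) (halts_BCDE w y)).mono ?_
  rw [tBound_eval, length_boolPair]
  exact bound_arith w.length y.length

/-- Phase A rejects an input that is not a pair. [folklore] -/
theorem halts_bad (z : List Bool) (h : unpairA [] z = none) :
    Halts ⟨0, mk { R0 with inp := z }⟩ false (tBound.eval z.length) :=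
  (phaseA_none R0 rfl [] z h).mono (by rw [tBound_eval]; nlinarith)

/-- The initial configuration of `SProg.init` in register-file form. [folklore] -/
theorem init_eq (z : List Bool) : (SProg.init z : SCfg 11) = ⟨0, mk { R0 with inp := z }⟩ := by
  simp only [SProg.init, SCfg.mk.injEq, true_and]
  funext k
  fin_cases k <;> simp [R0]

/-- **The checker's string function**: the output register after the clocked run of the
program (`SProg.outputFn_mem_FP`). [folklore] -/
noncomputable def tautFn (z : List Bool) : List Bool :=
  (tautProg.step^[z.length + tBound.eval z.length] (SProg.init z)).regs 9

/-- It is polynomial-time computable (stack register programs run in polynomial time on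
`TM2`, `SProg.outputFn_mem_FP`). [Minsky 1967, §11.1, §14.1; Arora–Barak 2009, §1.3–1.4]
[folklore] -/
theorem tautFn_mem_FP : tautFn ∈ FP := SProg.outputFn_mem_FP tautProg 9 tBound

/-- On pairs it computes the checker `chkTaut`. [folklore] -/
theorem tautFn_boolPair (w y : List Bool) : tautFn (boolPair w y) = [chkTaut w y] := by
  unfold tautFn
  rw [init_eq]
  exact (halts_boolPair w y).regs_out (by omega)

/-- Its values are `[true]` or `[false]`. [folklore] -/
theorem tautFn_cases (z : List Bool) : tautFn z = [true] ∨ tautFn z = [false] := by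
  cases h : unpairA [] z with
  | none =>
    right
    unfold tautFn
    rw [init_eq]
    exact (halts_bad z h).regs_out (by omega)
  | some p =>
    obtain ⟨wr, y⟩ := p
    obtain ⟨w, -, rfl⟩ := unpairA_sound [] z wr y h
    rw [tautFn_boolPair]
    cases chkTaut w y <;> simp

end TautProg

/-- **`TAUT ∈ coNP`** (discharging the named fact `TAUT_mem_coNP` of `CNF.lean`): the stack
register program `TautProg.tautProg` implements the certificate checker `chkTaut` of
`TautCertificates.lean` in polynomial time (`TautProg.tautFn_mem_FP`, `tautFn_boolPair`), so
`TAUT_mem_coNP_of_checker` applies: a falsifying assignment, presented as a table, certifies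
non-membership in `TAUT`, and non-codewords are accepted outright. [Cook 1971, §1;
Arora–Barak 2009, Example 2.21] [cite: Cook1971, §1] -/
theorem TAUT_mem_coNP_holds : TAUT_mem_coNP :=
  TAUT_mem_coNP_of_checker TautProg.tautFn_mem_FP TautProg.tautFn_cases TautProg.tautFn_boolPair

namespace TautProg

end TautProg

end Literature.Computability.Complexity
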